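/-
Copyright: lit-balaban cell (HOME `run/shared/lean/pub/lit-balaban/`), Phase-2 proof seat p12 (gen 7).  The proofs reproduce the
printed arguments; nothing is claimed beyond what the kernel checks below.
-/
import Mathlib.Topology.MetricSpace.Contracting
import Mathlib.Analysis.Quaternion
import Literature.MathematicalPhysics.QuantumFieldTheory.DybalskiStottmeisterTanimoto2024.DST24RemainderLipschitz
import Literature.MathematicalPhysics.QuantumFieldTheory.DybalskiStottmeisterTanimoto2024.DST24CoarseBonds

/-!
# `DybalskiStottmeisterTanimoto2024.DST24MainTheorem` — [DybalskiStottmeisterTanimoto2024] **§4.1 (the main line) and §4.4: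
# the space `X_ε` and the equality of configuration spaces, the map `𝕋`, Propositions (preserving-space), (contraction),
# Lemma (D-lemma), Lemma (Q-G-R-Q-lemma), Theorem (Banach) ⇒ Theorem (main-theorem-intext) = Theorem 1** — PROVED from the one
# remaining `𝓛^∞` input, Lemma (infty-bounds) (`‖Γ‖_{∞,∞;Ω} ≤ C`, `‖(QΓQ*)⁻¹‖_{∞,∞;Ω₁} ≤ C` uniformly in `n`), taken as explicit hypotheses

statement-level skeleton of published theorems with citation tags; proofs where landed; nothing here is a claim about
the Yang–Mills mass gap

W. Dybalski, A. Stottmeister, Y. Tanimoto, *The Bałaban variational problem in the non-linear sigma model*, Rev. Math. Phys.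
**36** (2024), arXiv:2403.09800; source held `paper:arxiv-2403.09800` (§4.1 = tex chunks p0011–p0012, §4.4 = p0015–p0016).  Unit
`lit-balaban-p12` (gen 7).  `‖·‖_{∞;Ω}` is the sup norm of the `Π`-type `Site L n₁ → su2` (Mathlib), `‖·‖_{∞,∞}` bounds are stated
as `∀ f, ‖T f‖ ≤ C‖f‖`.  `[A⃗]` = `brk`/`brkConf` (`DST24RemainderLipschitz`), Lemma (configurations) = `vecOf_Uprime_small`
(`DST24Configurations`), Theorem (critical-point-equation) = `critical_point_equation`, `QΓQ*` invertible = `QGammaQstar`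
(`DST24GreenFunction`), Lemmas (r-lemma-one/two) = `r_lemma_one`/`r_lemma_two`, (R-bound-one/three) from `DST24RstarBounds`.
This file closes the main line of the paper: `Theorem1 L` (`DST24Setting`) follows from Lemma (infty-bounds) alone
(`theorem1_of_infty_bounds`); that lemma (§4.3 with §4.4 method of images and Appendix A, cf. `DST24RandomWalkAppendix`) is NOT
proved here and enters as the hypotheses `hΓ`, `hQ`, stated uniformly in `n₁` exactly as printed.  In finite dimensions the
Neumann series of §4.4 is replaced by: `1 + S` with `‖S‖ ≤ ½` is injective, hence bijective, with the same bound `‖(1+S)⁻¹‖ ≤ 2`.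

WHAT IS PRINTED AND PROVED HERE — §4.1 “The space `X_ε`”.
* «we define the following notion of distance from zero `d₀(A⃗, 0) = sup_{b∈Ω}‖[A⃗](b₋)∂V(y_b)[A⃗](b₊)* − 1‖ = sup_{b∈Ω}‖(∂U)(b) − 1‖`,
  which is dictated by the small field condition» — `liftConf` (`U = [A⃗]V = U′V`), `pd_liftConf`; «`X_ε := {A⃗ ∈ Conf⃗^{4c_{1/2}L²ε}(Ω) |
  Q(A⃗) = 0, d₀(A⃗, 0) ≤ ε}`» — `Xeps L κ ε V` (amplitude bound `κ` kept as a parameter; Lemma (configurations) gives `κ = 4c·L·ε` here,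
  cf. `DST24Configurations`).
* «`X_ε` consists precisely of configurations satisfying the small field condition and the constraint.  … any configuration from
  Theorem (main-theorem) is contained in `X_ε`» — `Avec_Uprime_mem_Xeps`, `liftConf_Avec_Uprime` (`[A⃗(U′)]V = U`); «the opposite
  inclusion: Any configuration `A⃗ ∈ Conf⃗^{…}(Ω)` gives one element `U′ = [A⃗]` … This provides us with `U = U′V ∈ Conf(Ω)`.  Then the
  condition `d₀(A⃗, 0) ≤ ε` is only satisfied if `U ∈ Conf_ε(Ω)`.  Now by reversing the steps in Subsection (simplification) we check
  that this configuration satisfies the constraint `𝒞(U) = V`» — `C0_Uprime_liftConf` (`𝒞₀(U′)(y) = L⁻²Σ_x A₀(x) > 0` when `Q A⃗ = 0`),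
  `avg_liftConf` (the constraint), `Avec_Uprime_liftConf` (`A⃗([A⃗]) = A⃗`), `liftConf_mem_smallField`.

§4.1 “The map `𝕋`”, Propositions (preserving-space), (contraction), §4.4 Lemma (D-lemma), Theorem 1.
* «`𝕋(A⃗) := (ΓR*_{A⃗}Q*[QΓR*_{A⃗}Q*]⁻¹Q − 1)Γ∂*r⃗_{A⃗}`», «`𝕋(A⃗) = (M_{A⃗} − 1)Γ∂*r⃗_{A⃗}`, `M_{A⃗} := ΓR*_{A⃗}Q*[QΓR*_{A⃗}Q*]⁻¹Q`» —
  `Tmap`, `Mmap`, `Tmap_eq`; «It is manifest from definition (T-def-0) that `𝕋` preserves the constraint, i.e. `Q(𝕋(A⃗)) = 0`» — `Q_Tmap`.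
* The fixed-point equation `𝕋(A⃗) = A⃗` on `X_ε` is the critical point equation (fixed-point-eq-them) of Theorem (critical-point-equation)
  for `U = [A⃗]V` — `Tmap_eq_self_iff`.
* `𝓛^∞` operator bounds: `‖Q‖ ≤ 1`, `‖Q*‖ ≤ 1` — `norm_Q_le`, `norm_Qstar_le`; «by Lemmas (R-lemma), (R-lemma-two)» `‖R*_{A⃗}‖ ≤ 2`,
  `‖R*_{A⃗₁} − R*_{A⃗₂}‖ ≤ 2‖A⃗₁ − A⃗₂‖` — `norm_RstarOp_le'`, `norm_RstarOp_sub_le'`.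
* **Lemma (D-lemma)** «`‖D_{A⃗₁}⁻¹ − D_{A⃗₂}⁻¹‖ ≤ ‖D_{A⃗₁}⁻¹(D_{A⃗₂} − D_{A⃗₁})D_{A⃗₂}⁻¹‖ ≤ 2‖Γ‖‖D_{A⃗₁}⁻¹‖‖D_{A⃗₂}⁻¹‖‖A⃗₁ − A⃗₂‖`» —
  `norm_Dinv_sub_le`.
* Proposition (preserving-space): «`‖𝕋(A⃗)‖_{∞;Ω} ≤ C‖∂*r⃗‖ ≤ 24C(ε² + ε₁)`» (T-invariance-bound) — `norm_Mmap_le`, `norm_Tmap_le`;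
  «`‖[𝕋(A⃗)](b₋)∂V(y_b)[𝕋(A⃗)](b₊)* − 1‖ ≤ ε₁ + ‖[𝕋(A⃗)](b₋)[𝕋(A⃗)](b₊)* − 1‖`», «`= ‖[𝕋(A⃗)](b₋) − [𝕋(A⃗)](b₊)‖ ≤ …`» —
  `norm_mul_mul_star_sub_one_le`, `norm_brk_sub_brk_le`, `d0_liftConf_le`; «`𝕋` maps `X_ε` into itself» — `Tmap_mem_Xeps`.
* Proposition (contraction): (shift-one)/(shift-two), (M-difference) «`‖M_{A⃗₂} − M_{A⃗₁}‖ ≤ 2‖Γ‖2‖D₁⁻¹‖‖D₂⁻¹‖‖A⃗₁−A⃗₂‖ +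
  ‖Γ‖‖D₁⁻¹‖‖A⃗₁−A⃗₂‖`» (with the factors `‖R*‖ ≤ 2`, `‖Γ‖` explicit) — `norm_Mmap_sub_le`, `norm_Tmap_sub_le`.
* Theorem (Banach) — Mathlib `ContractingWith.exists_fixedPoint'`; «Since `X_ε` is a closed subset of `ℝ^{3n²}`, the completeness of
  `X_ε` in the metric `d` is clear» — `isClosed_Xeps`; `0 ∈ X_ε` — `zero_mem_Xeps`.
* Theorem (main-theorem-intext) «for `ε, ε₁` sufficiently small (uniformly in `n`) there is a unique solution `A⃗ ∈ X_ε` of the equation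
  `𝕋(A⃗) = A⃗`.  Consequently, there exists a unique critical point of the action (action-one-x) with the constraint (constraint) over
  the set `𝔘_ε`» — `existsUnique_fixedPoint`, `existsUnique_critical`, the explicit smallness `eps_choice` (`ε₁ = ε²`), and
  **`theorem1_of_Linfty_bounds : … → Theorem1 L`**.

§4.4 Lemma (Q-G-R-Q-lemma) and the final reduction.
* «We define `δR*_{A⃗} := R*_{A⃗} − 1`.  It has the form `δR*_{A⃗}(x)v⃗(x) = (A₀(x) − 1)v⃗(x) − A⃗(x) × v⃗(x)` and satisfies …
  `‖δR_{A⃗}(x)‖ ≤ |A₀(x) − 1| + |A⃗(x)| ≤ 2ε`» (dRA) — `norm_Rstar_sub_self_le`, `norm_RstarOp_sub_self_le`.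
* «`QΓR*_{A⃗}Q* = (QΓQ*)(1 + (QΓQ*)⁻¹QΓδR*_{A⃗}Q*)`.  The first factor is invertible by part 3. of Lemma (inverse-lemma).  The second
  factor is invertible provided that `‖(QΓQ*)⁻¹QΓδR*_{A⃗}Q*‖ ≤ ‖(QΓQ*)⁻¹‖‖QΓδR*_{A⃗}Q*‖ < 1`», «for `C′ε ≤ 1/2` we can sum up and estimate
  the Neumann series … `‖(QΓR*_{A⃗}Q*)⁻¹‖ ≤ C″/(1 − C′ε) ≤ 2C″`» — `Dop_eq`, `norm_pert_le`, `Dop_injective`, `DinvStd`, `DinvStd_Dop`, `Dop_DinvStd`;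
  **Lemma (Q-G-R-Q-lemma)** «The operator `D_{A⃗} := QΓR*_{A⃗}Q*` is invertible and … `‖(QΓR*_{A⃗}Q*)⁻¹‖_{∞,∞;Ω₁} ≤ C` provided that
  `0 < ε ≤ 1` sufficiently small (uniformly in `n`)» — `QGRQ_lemma` (with `C = 2C_Q`, `ε ≤ κ₀ = 1/(4C_QC_Γ + 4)` explicit in terms of the
  constants `C_Γ`, `C_Q` of Lemma (infty-bounds)).
* Consequently Theorem (main-theorem-intext)/Theorem 1 from Lemma (infty-bounds) alone — `theorem1_of_infty_bounds`.
-/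

namespace Literature.MathematicalPhysics.QuantumFieldTheory.DybalskiStottmeisterTanimoto2024.DST24MainTheorem

open scoped Quaternion RealInnerProductSpace BigOperators NNReal Topology
open Literature.MathematicalPhysics.QuantumFieldTheory.Federbush1986
open Literature.MathematicalPhysics.QuantumFieldTheory.DybalskiStottmeisterTanimoto2024.DST24Setting
open Literature.MathematicalPhysics.QuantumFieldTheory.DybalskiStottmeisterTanimoto2024.DST24Configurations
open Literature.MathematicalPhysics.QuantumFieldTheory.DybalskiStottmeisterTanimoto2024.DST24LinearConstraint
open Literature.MathematicalPhysics.QuantumFieldTheory.DybalskiStottmeisterTanimoto2024.DST24TangentSpace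
open Literature.MathematicalPhysics.QuantumFieldTheory.DybalskiStottmeisterTanimoto2024.DST24CriticalPoint
open Literature.MathematicalPhysics.QuantumFieldTheory.DybalskiStottmeisterTanimoto2024.DST24GreenFunction
open Literature.MathematicalPhysics.QuantumFieldTheory.DybalskiStottmeisterTanimoto2024.DST24CriticalPointEquation
open Literature.MathematicalPhysics.QuantumFieldTheory.DybalskiStottmeisterTanimoto2024.DST24RemainderBounds
open Literature.MathematicalPhysics.QuantumFieldTheory.DybalskiStottmeisterTanimoto2024.DST24RstarBounds hiding norm_crossLin_le
open Literature.MathematicalPhysics.QuantumFieldTheory.DybalskiStottmeisterTanimoto2024.DST24RemainderLipschitz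
open Literature.MathematicalPhysics.QuantumFieldTheory.DybalskiStottmeisterTanimoto2024.DST24CoarseBonds

noncomputable section

variable {L n₁ : ℕ}

/-! ## `U = [A⃗]V` and the space `X_ε` -/

/-- «This provides us with `U = U′V ∈ Conf(Ω)`» with `U′ = [A⃗]`: the configuration of a vector field.
[cite: DybalskiStottmeisterTanimoto2024, §4.1 “The space `X_ε`”] -/
def liftConf (A : Site L n₁ → su2) (V : CConf n₁) : Conf L n₁ := fun x => brk (A x) * V (blk x)

/-- [cite: DybalskiStottmeisterTanimoto2024, §4.1 “The space `X_ε`” («`U = U′V`»)] -/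
theorem liftConf_apply (A : Site L n₁ → su2) (V : CConf n₁) (x : Site L n₁) : liftConf A V x = brk (A x) * V (blk x) := rfl

/-- `U′ = [A⃗]` for `U = [A⃗]V`. [cite: DybalskiStottmeisterTanimoto2024, §4.1 (bracket-relation); §2.1 (U-V)] -/
theorem Uprime_liftConf (A : Site L n₁ → su2) (V : CConf n₁) : Uprime (liftConf A V) V = brkConf A := by
  funext x
  rw [Uprime, liftConf_apply, mul_inv_cancel_right]
  rfl

/-- «`d₀(A⃗, 0) = sup_{b∈Ω}‖[A⃗](b₋)∂V(y_b)[A⃗](b₊)* − 1‖ = sup_b‖(∂U)(b) − 1‖`»: `(∂U)(b) = [A⃗](b₋)∂V(y_b)[A⃗](b₊)*`.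
[cite: DybalskiStottmeisterTanimoto2024, §4.1 (d₀)] -/
theorem pd_liftConf_val (A : Site L n₁ → su2) (V : CConf n₁) (b : Bond L n₁) :
    (pd (liftConf A V) b).val = (brk (A b.src)).val * pdV V b * star (brk (A b.tgt)).val := by
  rw [pd_val_eq_Wq, Uprime_liftConf]; rfl

/-- «`X_ε := {A⃗ ∈ Conf⃗^{κ}(Ω) | Q(A⃗) = 0, d₀(A⃗, 0) ≤ ε}`» (with `κ = 4c_{1/2}L²ε` in print; here a parameter).
[cite: DybalskiStottmeisterTanimoto2024, §4.1 (X_ε)] -/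
def Xeps (L : ℕ) {n₁ : ℕ} (κ ε : ℝ) (V : CConf n₁) : Set (Site L n₁ → su2) :=
  {A | (∀ x, ‖A x‖ ≤ κ) ∧ Q L A = 0 ∧ liftConf A V ∈ smallField ε}

/-- [cite: DybalskiStottmeisterTanimoto2024, §4.1 (X_ε)] -/
theorem mem_Xeps {κ ε : ℝ} {V : CConf n₁} {A : Site L n₁ → su2} :
    A ∈ Xeps L κ ε V ↔ (∀ x, ‖A x‖ ≤ κ) ∧ Q L A = 0 ∧ liftConf A V ∈ smallField ε := Iff.rfl

/-! ## `𝔘_ε(Ω) ∩ {𝒞(U) = V} → X_ε` -/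

/-- «`½Tr(U′(x)σ⃗) = A⃗(x)`» then `[A⃗]V = U′V = U`: the vector field of a small constrained configuration lifts back to it.
[cite: DybalskiStottmeisterTanimoto2024, §4.1 (bracket-relation) («the inverse is simple»)] -/
theorem liftConf_Avec_Uprime (hL : 0 < L) {ε : ℝ} (hε : 0 < ε) (h1 : 4 * ch * L * ε ≤ 1) {U : Conf L n₁}
    (hU : U ∈ smallField ε) {V : CConf n₁} (hC : avg U = V) : liftConf (Avec (Uprime U V)) V = U := by
  funext x
  rw [liftConf_apply, Avec, brk_vecOf _ (re_Uprime_nonneg hL hε h1 hU hC x), Uprime_mul]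

/-- «it is clear that any configuration from Theorem (main-theorem) is contained in `X_ε`»: for `U ∈ 𝔘_ε(Ω)` with `𝒞(U) = V`
(regime `4c·L·ε ≤ 1`), `A⃗(U′) ∈ X_ε` with `κ = 4c·L·ε` (Lemma (configurations), (first-implication), the constraint `QA⃗ = 0`).
[cite: DybalskiStottmeisterTanimoto2024, §4.1 “The space `X_ε`”; §2.2 Theorem (configurations-theorem)] -/
theorem Avec_Uprime_mem_Xeps (hL : 0 < L) {ε : ℝ} (hε : 0 < ε) (h1 : 4 * ch * L * ε ≤ 1) {U : Conf L n₁}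
    (hU : U ∈ smallField ε) {V : CConf n₁} (hC : avg U = V) : Avec (Uprime U V) ∈ Xeps L (4 * ch * L * ε) ε V := by
  refine ⟨fun x => (vecOf_Uprime_small hL hε h1 hU hC x).1, Q_Avec_eq_zero hL hε h1 hU hC, ?_⟩
  rw [liftConf_Avec_Uprime hL hε h1 hU hC]
  exact hU

/-! ## `X_ε → 𝔘_ε(Ω) ∩ {𝒞(U) = V}` -/

/-- `A⃗([A⃗]) = A⃗`: `A⃗(U′) = A⃗` for `U = [A⃗]V`. [cite: DybalskiStottmeisterTanimoto2024, §4.1 (bracket-relation)] -/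
theorem Avec_Uprime_liftConf {A : Site L n₁ → su2} (hA : ∀ x, ‖A x‖ ≤ 1) (V : CConf n₁) :
    Avec (Uprime (liftConf A V) V) = A := by
  funext x
  rw [Uprime_liftConf]
  exact Avec_brkConf A hA x

/-- `B₁(y)` is non-empty (`L ≥ 1`). [cite: DybalskiStottmeisterTanimoto2024, §1.1 (box)] -/
theorem box_nonempty (hL : 0 < L) (y : CSite n₁) : (box L y).Nonempty :=
  ⟨corner hL y, mem_box.mpr (blk_corner hL y)⟩

/-- `Σ` commutes with `ℝ ↪ ℍ`. [cite: DybalskiStottmeisterTanimoto2024, §1.1 («as a quaternion»)] -/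
theorem coe_finset_sum {ι : Type*} (s : Finset ι) (f : ι → ℝ) : (((∑ i ∈ s, f i : ℝ)) : ℍ) = ∑ i ∈ s, ((f i : ℝ) : ℍ) := by
  induction s using Finset.cons_induction with
  | empty => rw [Finset.sum_empty, Finset.sum_empty, Quaternion.coe_zero]
  | cons a s h ih => rw [Finset.sum_cons, Finset.sum_cons, Quaternion.coe_add, ih]

/-- «by reversing the steps in Subsection (simplification)»: for `U′ = [A⃗]` with `QA⃗ = 0`,
`𝒞₀(U′)(y) = L⁻² Σ_{x∈B(y)} A₀(x)` is a real number. [cite: DybalskiStottmeisterTanimoto2024, §4.1 “The space `X_ε`”; §2.1 (first-implication)] -/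
theorem C0_Uprime_liftConf (hL : 0 < L) {A : Site L n₁ → su2} (hA : ∀ x, ‖A x‖ ≤ 1) (hQ : Q L A = 0) (V : CConf n₁)
    (y : CSite n₁) :
    C0 (Uprime (liftConf A V) V) y = (((((L : ℝ) ^ 2)⁻¹ * ∑ x ∈ box L y, A0 (A x) : ℝ)) : ℍ) := by
  have hQy : ∑ x ∈ box L y, A x = 0 := (Q_eq_zero_iff hL A y).mp (by rw [hQ]; rfl)
  have hQy' : ∑ x ∈ box L y, (A x : ℍ) = 0 := by rw [← Submodule.coe_sum, hQy, Submodule.coe_zero]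
  rw [Uprime_liftConf, C0]
  simp only [brkConf, brk_val _ (hA _), Finset.sum_sub_distrib, hQy', sub_zero]
  rw [← coe_finset_sum, Quaternion.coe_mul, Quaternion.coe_mul_eq_smul]

/-- `𝒞₀(U′)(y) > 0` as a real number, for `|A⃗(x)| < 1`. [cite: DybalskiStottmeisterTanimoto2024, §4.1 “The space `X_ε`”] -/
theorem C0_Uprime_liftConf_pos (hL : 0 < L) {κ : ℝ} (hκ : κ < 1) {A : Site L n₁ → su2} (hA : ∀ x, ‖A x‖ ≤ κ)
    (y : CSite n₁) : 0 < ((L : ℝ) ^ 2)⁻¹ * ∑ x ∈ box L y, A0 (A x) := by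
  have hLr : (0 : ℝ) < L := by exact_mod_cast hL
  refine mul_pos (by positivity) (Finset.sum_pos (fun x _ => ?_) (box_nonempty hL y))
  unfold A0
  apply Real.sqrt_pos.mpr
  have h := hA x
  have h0 := norm_nonneg (A x)
  nlinarith

/-- **The constraint for `U = [A⃗]V`.** «Now by reversing the steps in Subsection (simplification) we check that this configuration
satisfies the constraint `𝒞(U) = V`» (for `A⃗ ∈ Conf⃗^κ(Ω)`, `κ < 1`, `QA⃗ = 0`). [cite: DybalskiStottmeisterTanimoto2024, §4.1 “The space `X_ε`”] -/
theorem avg_liftConf (hL : 0 < L) {κ : ℝ} (hκ : κ < 1) {A : Site L n₁ → su2} (hA : ∀ x, ‖A x‖ ≤ κ) (hQ : Q L A = 0)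
    (V : CConf n₁) : avg (liftConf A V) = V := by
  have hA1 : ∀ x, ‖A x‖ ≤ 1 := fun x => (hA x).trans hκ.le
  funext y
  set r : ℝ := ((L : ℝ) ^ 2)⁻¹ * ∑ x ∈ box L y, A0 (A x) with hr
  have hrpos : 0 < r := C0_Uprime_liftConf_pos hL hκ hA y
  have hC0' : C0 (Uprime (liftConf A V) V) y = (r : ℍ) := C0_Uprime_liftConf hL hA1 hQ V y
  have h0 : C0 (liftConf A V) y ≠ 0 := by
    rw [C0_eq_C0_Uprime_mul _ V, hC0']
    exact mul_ne_zero (fun h => hrpos.ne' (Quaternion.coe_injective (h.trans Quaternion.coe_zero.symm))) (SU2.val_ne_zero _)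
  rw [constraint_iff_C0_real h0, hC0', Quaternion.norm_coe, Real.norm_of_nonneg hrpos.le]

/-- `U = [A⃗]V ∈ 𝔘_ε(Ω)` is the condition «`d₀(A⃗, 0) ≤ ε`» of `X_ε`. [cite: DybalskiStottmeisterTanimoto2024, §4.1 (d₀), (X_ε)] -/
theorem liftConf_mem_smallField {κ ε : ℝ} {V : CConf n₁} {A : Site L n₁ → su2} (h : A ∈ Xeps L κ ε V) :
    liftConf A V ∈ smallField ε := h.2.2

/-- **Equality of configuration spaces** («This equality of configuration spaces is important»): for `κ = 4c·L·ε < 1`,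
`A⃗ ∈ X_ε` iff `A⃗ = A⃗(U′)` for some `U ∈ 𝔘_ε(Ω)` with `𝒞(U) = V`, and then `U = [A⃗]V`.
[cite: DybalskiStottmeisterTanimoto2024, §4.1 “The space `X_ε`”] -/
theorem mem_Xeps_iff (hL : 0 < L) {ε : ℝ} (hε : 0 < ε) (h1 : 4 * ch * L * ε < 1) {V : CConf n₁} {A : Site L n₁ → su2} :
    A ∈ Xeps L (4 * ch * L * ε) ε V ↔
      ∃ U : Conf L n₁, U ∈ smallField ε ∧ avg U = V ∧ A = Avec (Uprime U V) := by
  constructor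
  · intro h
    refine ⟨liftConf A V, h.2.2, avg_liftConf hL h1 h.1 h.2.1 V, ?_⟩
    rw [Avec_Uprime_liftConf (fun x => (h.1 x).trans h1.le)]
  · rintro ⟨U, hU, hC, rfl⟩
    exact Avec_Uprime_mem_Xeps hL hε h1.le hU hC



/-! ## The maps `M_{A⃗}` and `𝕋` -/

/-- «`M_{A⃗} := ΓR*_{A⃗}Q*[QΓR*_{A⃗}Q*]⁻¹Q`» with the inverse supplied as `Dinv A⃗`. [cite: DybalskiStottmeisterTanimoto2024, §4.1 proof of Prop. (contraction) (M-def)] -/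
def Mmap (hL : 0 < L) (Dinv : (Site L n₁ → su2) → ((CSite n₁ → su2) →ₗ[ℝ] (CSite n₁ → su2))) (A : Site L n₁ → su2)
    (f : Site L n₁ → su2) : Site L n₁ → su2 :=
  Gamma hL (RstarOp A (Qstar L (Dinv A (Q L f))))

/-- «`𝕋(A⃗) := (ΓR*_{A⃗}Q*[QΓR*_{A⃗}Q*]⁻¹Q − 1)Γ∂*r⃗_{A⃗}`» (`r⃗_{A⃗}` the remainder of `U′ = [A⃗]`). [cite: DybalskiStottmeisterTanimoto2024, §4.1 (T-def-0)] -/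
def Tmap (hL : 0 < L) (Dinv : (Site L n₁ → su2) → ((CSite n₁ → su2) →ₗ[ℝ] (CSite n₁ → su2))) (V : CConf n₁)
    (A : Site L n₁ → su2) : Site L n₁ → su2 :=
  Mmap hL Dinv A (Gamma hL (delStar (rvec (brkConf A) V))) - Gamma hL (delStar (rvec (brkConf A) V))

variable (hL : 0 < L) (Dinv : (Site L n₁ → su2) → ((CSite n₁ → su2) →ₗ[ℝ] (CSite n₁ → su2)))

/-- «`𝕋(A⃗) = (M_{A⃗} − 1)Γ∂*r⃗_{A⃗}`». [cite: DybalskiStottmeisterTanimoto2024, §4.1 (T-def)] -/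
theorem Tmap_eq (V : CConf n₁) (A : Site L n₁ → su2) :
    Tmap hL Dinv V A = Mmap hL Dinv A (Gamma hL (delStar (rvec (brkConf A) V))) - Gamma hL (delStar (rvec (brkConf A) V)) := rfl

/-- `Q(f − g) = Qf − Qg`. [cite: DybalskiStottmeisterTanimoto2024, §2.1 (2.5)] -/
theorem Q_sub {M : Type*} [AddCommGroup M] [Module ℝ M] (f g : Site L n₁ → M) : Q L (f - g) = Q L f - Q L g := by
  funext y; simp only [Q_apply, Pi.sub_apply, Finset.sum_sub_distrib, smul_sub]

/-- `Q*(f − g) = Q*f − Q*g`. [cite: DybalskiStottmeisterTanimoto2024, §2.1 (2.6)] -/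
theorem Qstar_sub {M : Type*} [AddCommGroup M] (c c' : CSite n₁ → M) : Qstar L (c - c') = Qstar L c - Qstar L c' := rfl

/-- `R*(f − g) = R*f − R*g`. [cite: DybalskiStottmeisterTanimoto2024, §3.3 (3.14′)] -/
theorem RstarOp_sub (A f g : Site L n₁ → su2) : RstarOp A (f - g) = RstarOp A f - RstarOp A g := by
  funext x; simp only [RstarOp_apply, Pi.sub_apply, map_sub]

/-- `M_{A⃗}` is linear: `M(f − g) = Mf − Mg`. [cite: DybalskiStottmeisterTanimoto2024, §4.1 (M-def)] -/
theorem Mmap_sub (A f g : Site L n₁ → su2) : Mmap hL Dinv A (f - g) = Mmap hL Dinv A f - Mmap hL Dinv A g := by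
  simp only [Mmap, Q_sub, map_sub, Qstar_sub, RstarOp_sub]

/-- `QM_{A⃗}f = D_{A⃗}D_{A⃗}⁻¹Qf = Qf`. [cite: DybalskiStottmeisterTanimoto2024, §4.1 proof of Prop. (preserving-space) («manifest from definition (T-def-0)»)] -/
theorem Q_Mmap {A : Site L n₁ → su2} (hDr : ∀ g, Dop hL A (Dinv A g) = g) (f : Site L n₁ → su2) :
    Q L (Mmap hL Dinv A f) = Q L f := by
  have h := hDr (Q L f)
  rw [Dop_apply] at h
  exact h

/-- «It is manifest from definition (T-def-0) that `𝕋` preserves the constraint, i.e., `Q(𝕋(A⃗)) = 0`.»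
[cite: DybalskiStottmeisterTanimoto2024, §4.1 proof of Prop. (preserving-space)] -/
theorem Q_Tmap {A : Site L n₁ → su2} (hDr : ∀ g, Dop hL A (Dinv A g) = g) (V : CConf n₁) : Q L (Tmap hL Dinv V A) = 0 := by
  rw [Tmap_eq, Q_sub, Q_Mmap hL Dinv hDr, sub_self]

/-- The linear equivalence `D_{A⃗}` assembled from `Dop` and a two-sided inverse. [cite: DybalskiStottmeisterTanimoto2024, §3.3 («Assuming that also `QΓR*Q*` is invertible»)] -/
def Dequiv {A : Site L n₁ → su2} (hDl : ∀ c, Dinv A (Dop hL A c) = c) (hDr : ∀ g, Dop hL A (Dinv A g) = g) :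
    (CSite n₁ → su2) ≃ₗ[ℝ] (CSite n₁ → su2) :=
  { Dop hL A with
    invFun := Dinv A
    left_inv := hDl
    right_inv := hDr }

/-- **The fixed-point equation is the critical point equation.**  For `A⃗ ∈ X_ε` (`κ = 4c·L·ε < 1`) and `D_{A⃗}` invertible:
`𝕋(A⃗) = A⃗` iff `U = [A⃗]V` is a critical point of the constrained action (Theorem (critical-point-equation), (fixed-point-eq-them)).
[cite: DybalskiStottmeisterTanimoto2024, §4.1 («the map `𝕋` is dictated by equation (fixed-point-eq-them)»); §3.3 Theorem (critical-point-equation)] -/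
theorem Tmap_eq_self_iff {ε : ℝ} (hε : 0 < ε) (h1 : 4 * ch * L * ε < 1) {V : CConf n₁} {A : Site L n₁ → su2}
    (hA : A ∈ Xeps L (4 * ch * L * ε) ε V) (hDl : ∀ c, Dinv A (Dop hL A c) = c) (hDr : ∀ g, Dop hL A (Dinv A g) = g) :
    Tmap hL Dinv V A = A ↔ IsConstrainedCritical V (liftConf A V) := by
  have hA1 : ∀ x, ‖A x‖ ≤ 1 := fun x => (hA.1 x).trans h1.le
  have hAv : Avec (Uprime (liftConf A V) V) = A := Avec_Uprime_liftConf hA1 V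
  have hU' : Uprime (liftConf A V) V = brkConf A := Uprime_liftConf A V
  have hcpe := critical_point_equation hL hε h1.le (liftConf_mem_smallField hA) (avg_liftConf hL h1 hA.1 hA.2.1 V)
    (Dequiv hL Dinv hDl hDr) (fun c => by rw [hAv]; rfl)
  rw [hcpe, hAv, hU', eq_comm]
  rfl

/-! ## `𝓛^∞` operator bounds -/

section Bounds

variable {E : Type*} [NormedAddCommGroup E] [NormedSpace ℝ E]

/-- `‖Qf‖_{∞;Ω₁} ≤ ‖f‖_{∞;Ω}` (an average over `L²` sites). [cite: DybalskiStottmeisterTanimoto2024, §2.1 (2.5); §4.3 («`Q : 𝓛^∞(Ω) → 𝓛^∞(Ω₁)`»)] -/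
theorem norm_Q_le (hL : 0 < L) (f : Site L n₁ → E) : ‖Q L f‖ ≤ ‖f‖ := by
  have hLr : (0 : ℝ) < L := by exact_mod_cast hL
  refine (pi_norm_le_iff_of_nonneg (norm_nonneg f)).mpr fun y => ?_
  rw [Q_apply, norm_smul, norm_inv, norm_pow, Real.norm_of_nonneg hLr.le]
  calc ((L : ℝ) ^ 2)⁻¹ * ‖∑ x ∈ box L y, f x‖ ≤ ((L : ℝ) ^ 2)⁻¹ * ∑ x ∈ box L y, ‖f‖ :=
        mul_le_mul_of_nonneg_left ((norm_sum_le _ _).trans (Finset.sum_le_sum fun x _ => norm_le_pi_norm f x))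
          (by positivity)
    _ = ‖f‖ := by
        rw [Finset.sum_const, card_box, nsmul_eq_mul]; push_cast
        field_simp

omit [NormedSpace ℝ E] in
/-- `‖Q*g‖_{∞;Ω} ≤ ‖g‖_{∞;Ω₁}`. [cite: DybalskiStottmeisterTanimoto2024, §2.1 (2.6); §4.3 («`Q* : 𝓛^∞(Ω₁) → 𝓛^∞(Ω)`»)] -/
theorem norm_Qstar_le (g : CSite n₁ → E) : ‖Qstar L g‖ ≤ ‖g‖ :=
  (pi_norm_le_iff_of_nonneg (norm_nonneg g)).mpr fun x => norm_le_pi_norm g (blk x)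

end Bounds

/-- (R-bound-one) as an operator bound: `‖R*_{A⃗}f‖_{∞;Ω} ≤ 2‖f‖_{∞;Ω}` for `|A⃗(x)| ≤ 1`. [cite: DybalskiStottmeisterTanimoto2024, §4.5 (R-bound-one)] -/
theorem norm_RstarOp_le' {A : Site L n₁ → su2} (hA : ∀ x, ‖A x‖ ≤ 1) (f : Site L n₁ → su2) : ‖RstarOp A f‖ ≤ 2 * ‖f‖ :=
  (pi_norm_le_iff_of_nonneg (by positivity)).mpr fun x =>
    (norm_Rstar_le (A x) (hA x) (f x)).trans (mul_le_mul_of_nonneg_left (norm_le_pi_norm f x) (by norm_num))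

/-- (R-bound-three) as an operator bound: `‖R*_{A⃗₁}f − R*_{A⃗₂}f‖_{∞;Ω} ≤ 2‖A⃗₁ − A⃗₂‖_{∞;Ω}‖f‖_{∞;Ω}` for `|A⃗ᵢ(x)| ≤ κ ≤ 1/2`.
[cite: DybalskiStottmeisterTanimoto2024, §4.5 (R-bound-three)] -/
theorem norm_RstarOp_sub_le' {κ : ℝ} (hκ : κ ≤ 1 / 2) {A₁ A₂ : Site L n₁ → su2} (h₁ : ∀ x, ‖A₁ x‖ ≤ κ) (h₂ : ∀ x, ‖A₂ x‖ ≤ κ)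
    (f : Site L n₁ → su2) : ‖RstarOp A₁ f - RstarOp A₂ f‖ ≤ 2 * ‖A₁ - A₂‖ * ‖f‖ := by
  refine (pi_norm_le_iff_of_nonneg (by positivity)).mpr fun x => ?_
  rw [Pi.sub_apply, RstarOp_apply, RstarOp_apply]
  have hκ0 : 0 ≤ κ := (norm_nonneg _).trans (h₁ x)
  calc ‖Rstar (A₁ x) (f x) - Rstar (A₂ x) (f x)‖ ≤ (2 * κ + 1) * ‖f x‖ * ‖A₁ x - A₂ x‖ :=
        norm_Rstar_sub_Rstar_le hκ (A₁ x) (A₂ x) (h₁ x) (h₂ x) (f x)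
    _ ≤ 2 * ‖f‖ * ‖A₁ - A₂‖ := by
        have e1 : ‖A₁ x - A₂ x‖ ≤ ‖A₁ - A₂‖ := norm_le_pi_norm (A₁ - A₂) x
        exact mul_le_mul (mul_le_mul (by linarith) (norm_le_pi_norm f x) (norm_nonneg _) (by norm_num)) e1
          (norm_nonneg _) (by positivity)
    _ = 2 * ‖A₁ - A₂‖ * ‖f‖ := by ring

/-- `‖D_{A⃗₁}c − D_{A⃗₂}c‖ = ‖QΓ(R*_{A⃗₁} − R*_{A⃗₂})Q*c‖ ≤ 2‖Γ‖‖A⃗₁ − A⃗₂‖‖c‖`. [cite: DybalskiStottmeisterTanimoto2024, §4.4 proof of Lemma (D-lemma) («Using Lemma (R-lemma-two)»)] -/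
theorem norm_Dop_sub_le {κ CΓ : ℝ} (hκ : κ ≤ 1 / 2) (hCΓ : 0 ≤ CΓ) (hΓ : ∀ f : Site L n₁ → su2, ‖Gamma hL f‖ ≤ CΓ * ‖f‖)
    {A₁ A₂ : Site L n₁ → su2} (h₁ : ∀ x, ‖A₁ x‖ ≤ κ) (h₂ : ∀ x, ‖A₂ x‖ ≤ κ) (c : CSite n₁ → su2) :
    ‖Dop hL A₁ c - Dop hL A₂ c‖ ≤ 2 * CΓ * ‖A₁ - A₂‖ * ‖c‖ := by
  have e : Dop hL A₁ c - Dop hL A₂ c = Q L (Gamma hL (RstarOp A₁ (Qstar L c) - RstarOp A₂ (Qstar L c))) := by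
    rw [Dop_apply, Dop_apply, map_sub, Q_sub]
  rw [e]
  calc ‖Q L (Gamma hL (RstarOp A₁ (Qstar L c) - RstarOp A₂ (Qstar L c)))‖
      ≤ ‖Gamma hL (RstarOp A₁ (Qstar L c) - RstarOp A₂ (Qstar L c))‖ := norm_Q_le hL _
    _ ≤ CΓ * ‖RstarOp A₁ (Qstar L c) - RstarOp A₂ (Qstar L c)‖ := hΓ _
    _ ≤ CΓ * (2 * ‖A₁ - A₂‖ * ‖Qstar L c‖) := mul_le_mul_of_nonneg_left (norm_RstarOp_sub_le' hκ h₁ h₂ _) hCΓ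
    _ ≤ CΓ * (2 * ‖A₁ - A₂‖ * ‖c‖) :=
        mul_le_mul_of_nonneg_left (mul_le_mul_of_nonneg_left (norm_Qstar_le c) (by positivity)) hCΓ
    _ = 2 * CΓ * ‖A₁ - A₂‖ * ‖c‖ := by ring

/-- **Lemma (D-lemma).** «The operator `D_{A⃗} := QΓR*_{A⃗}Q*` satisfies `‖D_{A⃗₁}⁻¹ − D_{A⃗₂}⁻¹‖_{∞,∞;Ω} ≤
2‖Γ‖_{∞,∞;Ω}‖D_{A⃗₁}⁻¹‖_{∞,∞;Ω}‖D_{A⃗₂}⁻¹‖_{∞,∞;Ω}‖A⃗₁ − A⃗₂‖_{∞;Ω}`», via «`D_{A⃗₁}⁻¹ − D_{A⃗₂}⁻¹ = D_{A⃗₁}⁻¹(D_{A⃗₂} − D_{A⃗₁})D_{A⃗₂}⁻¹`».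
Here with `‖Γ‖ ≤ C_Γ`, `‖D_{A⃗ᵢ}⁻¹‖ ≤ C_D` and the inverses as hypotheses. [cite: DybalskiStottmeisterTanimoto2024, §4.4 Lemma (D-lemma)] -/
theorem norm_Dinv_sub_le {κ CΓ CD : ℝ} (hκ : κ ≤ 1 / 2) (hCΓ : 0 ≤ CΓ) (hCD : 0 ≤ CD)
    (hΓ : ∀ f : Site L n₁ → su2, ‖Gamma hL f‖ ≤ CΓ * ‖f‖) {A₁ A₂ : Site L n₁ → su2} (h₁ : ∀ x, ‖A₁ x‖ ≤ κ)
    (h₂ : ∀ x, ‖A₂ x‖ ≤ κ) (hD₁l : ∀ c, Dinv A₁ (Dop hL A₁ c) = c) (hD₂r : ∀ g, Dop hL A₂ (Dinv A₂ g) = g)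
    (hn₁ : ∀ g, ‖Dinv A₁ g‖ ≤ CD * ‖g‖) (hn₂ : ∀ g, ‖Dinv A₂ g‖ ≤ CD * ‖g‖) (g : CSite n₁ → su2) :
    ‖Dinv A₁ g - Dinv A₂ g‖ ≤ 2 * CΓ * CD ^ 2 * ‖A₁ - A₂‖ * ‖g‖ := by
  have e : Dinv A₁ g - Dinv A₂ g = Dinv A₁ (Dop hL A₂ (Dinv A₂ g) - Dop hL A₁ (Dinv A₂ g)) := by
    rw [map_sub, hD₁l, hD₂r]
  rw [e]
  calc ‖Dinv A₁ (Dop hL A₂ (Dinv A₂ g) - Dop hL A₁ (Dinv A₂ g))‖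
      ≤ CD * ‖Dop hL A₂ (Dinv A₂ g) - Dop hL A₁ (Dinv A₂ g)‖ := hn₁ _
    _ ≤ CD * (2 * CΓ * ‖A₂ - A₁‖ * ‖Dinv A₂ g‖) :=
        mul_le_mul_of_nonneg_left (norm_Dop_sub_le hL hκ hCΓ hΓ h₂ h₁ _) hCD
    _ ≤ CD * (2 * CΓ * ‖A₂ - A₁‖ * (CD * ‖g‖)) :=
        mul_le_mul_of_nonneg_left (mul_le_mul_of_nonneg_left (hn₂ g) (by positivity)) hCD
    _ = 2 * CΓ * CD ^ 2 * ‖A₁ - A₂‖ * ‖g‖ := by rw [norm_sub_rev]; ring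

/-- `‖M_{A⃗}f‖ ≤ ‖Γ‖‖R*‖‖D_{A⃗}⁻¹‖‖f‖ ≤ 2C_ΓC_D‖f‖` («all the `‖…‖_{∞,∞;Ω}`-norms above are bounded uniformly in `n` by Lemmas
(Q-G-R-Q-lemma), (infty-bounds), (R-lemma)»). [cite: DybalskiStottmeisterTanimoto2024, §4.1 proof of Prop. (contraction)] -/
theorem norm_Mmap_le {CΓ CD : ℝ} (hCΓ : 0 ≤ CΓ) (hCD : 0 ≤ CD) (hΓ : ∀ f : Site L n₁ → su2, ‖Gamma hL f‖ ≤ CΓ * ‖f‖)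
    {A : Site L n₁ → su2} (hA : ∀ x, ‖A x‖ ≤ 1) (hn : ∀ g, ‖Dinv A g‖ ≤ CD * ‖g‖) (f : Site L n₁ → su2) :
    ‖Mmap hL Dinv A f‖ ≤ 2 * CΓ * CD * ‖f‖ := by
  unfold Mmap
  calc ‖Gamma hL (RstarOp A (Qstar L (Dinv A (Q L f))))‖ ≤ CΓ * ‖RstarOp A (Qstar L (Dinv A (Q L f)))‖ := hΓ _
    _ ≤ CΓ * (2 * ‖Qstar L (Dinv A (Q L f))‖) := mul_le_mul_of_nonneg_left (norm_RstarOp_le' hA _) hCΓ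
    _ ≤ CΓ * (2 * (CD * ‖Q L f‖)) :=
        mul_le_mul_of_nonneg_left (mul_le_mul_of_nonneg_left ((norm_Qstar_le _).trans (hn _)) (by norm_num)) hCΓ
    _ ≤ CΓ * (2 * (CD * ‖f‖)) :=
        mul_le_mul_of_nonneg_left (mul_le_mul_of_nonneg_left (mul_le_mul_of_nonneg_left (norm_Q_le hL f) hCD)
          (by norm_num)) hCΓ
    _ = 2 * CΓ * CD * ‖f‖ := by ring

/-- (M-difference) «`M_{A⃗₂} − M_{A⃗₁} = ΓR*_{A⃗₂}Q*([D_{A⃗₂}]⁻¹ − [D_{A⃗₁}]⁻¹)Q + Γ(R*_{A⃗₂} − R*_{A⃗₁})Q*[D_{A⃗₁}]⁻¹Q`», hence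
«`‖M_{A⃗₂} − M_{A⃗₁}‖ ≤ 2‖Γ‖·2‖D₁⁻¹‖‖D₂⁻¹‖‖A⃗₁ − A⃗₂‖ + ‖Γ‖‖D₁⁻¹‖‖A⃗₁ − A⃗₂‖`» (here with the factors `‖R*‖ ≤ 2`, `‖Γ‖ ≤ C_Γ` of
(D-lemma) explicit: `≤ (4C_Γ²C_D² + 2C_ΓC_D)‖A⃗₁ − A⃗₂‖‖f‖`). [cite: DybalskiStottmeisterTanimoto2024, §4.1 proof of Prop. (contraction) (M-difference)] -/
theorem norm_Mmap_sub_le {κ CΓ CD : ℝ} (hκ : κ ≤ 1 / 2) (hCΓ : 0 ≤ CΓ) (hCD : 0 ≤ CD)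
    (hΓ : ∀ f : Site L n₁ → su2, ‖Gamma hL f‖ ≤ CΓ * ‖f‖) {A₁ A₂ : Site L n₁ → su2} (h₁ : ∀ x, ‖A₁ x‖ ≤ κ)
    (h₂ : ∀ x, ‖A₂ x‖ ≤ κ) (hD₁l : ∀ c, Dinv A₁ (Dop hL A₁ c) = c) (hD₂r : ∀ g, Dop hL A₂ (Dinv A₂ g) = g)
    (hn₁ : ∀ g, ‖Dinv A₁ g‖ ≤ CD * ‖g‖) (hn₂ : ∀ g, ‖Dinv A₂ g‖ ≤ CD * ‖g‖) (f : Site L n₁ → su2) :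
    ‖Mmap hL Dinv A₁ f - Mmap hL Dinv A₂ f‖ ≤ (4 * CΓ ^ 2 * CD ^ 2 + 2 * CΓ * CD) * ‖A₁ - A₂‖ * ‖f‖ := by
  have hκ1 : ∀ x, ‖A₁ x‖ ≤ 1 := fun x => (h₁ x).trans (by linarith)
  have e : Mmap hL Dinv A₁ f - Mmap hL Dinv A₂ f =
      Gamma hL (RstarOp A₁ (Qstar L (Dinv A₁ (Q L f) - Dinv A₂ (Q L f)))
        + (RstarOp A₁ (Qstar L (Dinv A₂ (Q L f))) - RstarOp A₂ (Qstar L (Dinv A₂ (Q L f))))) := by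
    rw [Mmap, Mmap, ← map_sub, Qstar_sub, RstarOp_sub]
    congr 1
    abel
  rw [e]
  have hδ := norm_nonneg (A₁ - A₂)
  have t1 : ‖RstarOp A₁ (Qstar L (Dinv A₁ (Q L f) - Dinv A₂ (Q L f)))‖ ≤ 2 * (2 * CΓ * CD ^ 2 * ‖A₁ - A₂‖ * ‖f‖) := by
    refine (norm_RstarOp_le' hκ1 _).trans (mul_le_mul_of_nonneg_left ?_ (by norm_num))
    refine (norm_Qstar_le _).trans ((norm_Dinv_sub_le hL Dinv hκ hCΓ hCD hΓ h₁ h₂ hD₁l hD₂r hn₁ hn₂ _).trans ?_)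
    exact mul_le_mul_of_nonneg_left (norm_Q_le hL f) (by positivity)
  have t2 : ‖RstarOp A₁ (Qstar L (Dinv A₂ (Q L f))) - RstarOp A₂ (Qstar L (Dinv A₂ (Q L f)))‖
      ≤ 2 * ‖A₁ - A₂‖ * (CD * ‖f‖) := by
    refine (norm_RstarOp_sub_le' hκ h₁ h₂ _).trans (mul_le_mul_of_nonneg_left ?_ (by positivity))
    exact (norm_Qstar_le _).trans ((hn₂ _).trans (mul_le_mul_of_nonneg_left (norm_Q_le hL f) hCD))
  calc _ ≤ CΓ * ‖RstarOp A₁ (Qstar L (Dinv A₁ (Q L f) - Dinv A₂ (Q L f)))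
        + (RstarOp A₁ (Qstar L (Dinv A₂ (Q L f))) - RstarOp A₂ (Qstar L (Dinv A₂ (Q L f))))‖ := hΓ _
    _ ≤ CΓ * (2 * (2 * CΓ * CD ^ 2 * ‖A₁ - A₂‖ * ‖f‖) + 2 * ‖A₁ - A₂‖ * (CD * ‖f‖)) :=
        mul_le_mul_of_nonneg_left (norm_add_le_of_le t1 t2) hCΓ
    _ = (4 * CΓ ^ 2 * CD ^ 2 + 2 * CΓ * CD) * ‖A₁ - A₂‖ * ‖f‖ := by ring

/-! ## The remainder in terms of `A⃗ ∈ Conf⃗^κ(Ω)` and `V ∈ 𝔘_{ε₁}(Ω₁)` -/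

/-- Lemma (r-lemma-one) in sup-norm form for `U′ = [A⃗]`, `|A⃗(x)| ≤ κ ≤ 1/2`, `V ∈ 𝔘_{ε₁}(Ω₁)`, `ε₁ ≤ 1/2`:
`‖∂*r⃗_{A⃗}‖_{∞;Ω} ≤ 24(κ² + ε₁)`. [cite: DybalskiStottmeisterTanimoto2024, §4.6 Lemma (r-lemma-one)] -/
theorem norm_delStar_rvec_le {κ ε₁ : ℝ} (hκ0 : 0 ≤ κ) (hκ : κ ≤ 1 / 2) (hε₁ : 0 ≤ ε₁) (hε₁' : ε₁ ≤ 1 / 2)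
    {A : Site L n₁ → su2} (hA : ∀ x, ‖A x‖ ≤ κ) {V : CConf n₁} (hV : V ∈ smallFieldC ε₁) :
    ‖delStar (rvec (brkConf A) V)‖ ≤ 24 * (κ ^ 2 + ε₁) := by
  have hA1 : ∀ x, ‖A x‖ ≤ 1 := fun x => (hA x).trans (by linarith)
  have hε₁1 : ε₁ ≤ 1 := by linarith
  refine (pi_norm_le_iff_of_nonneg (by positivity)).mpr fun x => ?_
  refine r_lemma_one hκ0 hκ hε₁ hε₁' (fun x => ?_) (fun x => ?_) (norm_vecOf_pdV_le hε₁ hε₁1 hV) (re_pdV_nonneg hε₁ hε₁1 hV) x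
  · rw [Avec_brkConf A hA1]; exact hA x
  · simp only [brkConf]; rw [re_brk _ (hA1 x)]; exact A0_nonneg _

/-- Lemma (r-lemma-two) in sup-norm form: `‖∂*r⃗_{A⃗₁} − ∂*r⃗_{A⃗₂}‖_{∞;Ω} ≤ 96(κ + ε₁)‖A⃗₁ − A⃗₂‖_{∞;Ω}`.
[cite: DybalskiStottmeisterTanimoto2024, §4.6 Lemma (r-lemma-two)] -/
theorem norm_delStar_rvec_sub_le {κ ε₁ : ℝ} (hκ0 : 0 ≤ κ) (hκ : κ ≤ 1 / 2) (hε₁ : 0 ≤ ε₁) (hε₁' : ε₁ ≤ 1 / 2)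
    {A₁ A₂ : Site L n₁ → su2} (h₁ : ∀ x, ‖A₁ x‖ ≤ κ) (h₂ : ∀ x, ‖A₂ x‖ ≤ κ) {V : CConf n₁} (hV : V ∈ smallFieldC ε₁) :
    ‖delStar (rvec (brkConf A₁) V) - delStar (rvec (brkConf A₂) V)‖ ≤ 96 * (κ + ε₁) * ‖A₁ - A₂‖ := by
  have hε₁1 : ε₁ ≤ 1 := by linarith
  refine (pi_norm_le_iff_of_nonneg (by positivity)).mpr fun x => ?_
  rw [Pi.sub_apply]
  exact r_lemma_two hκ0 hκ hε₁ hε₁' A₁ A₂ h₁ h₂ (norm_vecOf_pdV_le hε₁ hε₁1 hV) (re_pdV_nonneg hε₁ hε₁1 hV)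
    (fun x => norm_le_pi_norm (A₁ - A₂) x) x

/-! ## Proposition (preserving-space): the estimates -/

/-- **(T-invariance-bound)** «`‖𝕋(A⃗)‖_{∞;Ω} ≤ C‖∂*r⃗‖_{∞;Ω} ≤ 24C(ε² + ε₁)`» with `C = C_Γ(2C_ΓC_D + 1)` explicit.
[cite: DybalskiStottmeisterTanimoto2024, §4.1 proof of Prop. (preserving-space) (T-invariance-bound)] -/
theorem norm_Tmap_le {κ ε₁ CΓ CD : ℝ} (hκ0 : 0 ≤ κ) (hκ : κ ≤ 1 / 2) (hε₁ : 0 ≤ ε₁) (hε₁' : ε₁ ≤ 1 / 2) (hCΓ : 0 ≤ CΓ)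
    (hCD : 0 ≤ CD) (hΓ : ∀ f : Site L n₁ → su2, ‖Gamma hL f‖ ≤ CΓ * ‖f‖) {A : Site L n₁ → su2} (hA : ∀ x, ‖A x‖ ≤ κ)
    (hn : ∀ g, ‖Dinv A g‖ ≤ CD * ‖g‖) {V : CConf n₁} (hV : V ∈ smallFieldC ε₁) :
    ‖Tmap hL Dinv V A‖ ≤ CΓ * (2 * CΓ * CD + 1) * (24 * (κ ^ 2 + ε₁)) := by
  have hA1 : ∀ x, ‖A x‖ ≤ 1 := fun x => (hA x).trans (by linarith)
  have hr := norm_delStar_rvec_le hκ0 hκ hε₁ hε₁' hA hV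
  have hg : ‖Gamma hL (delStar (rvec (brkConf A) V))‖ ≤ CΓ * (24 * (κ ^ 2 + ε₁)) :=
    (hΓ _).trans (mul_le_mul_of_nonneg_left hr hCΓ)
  rw [Tmap_eq]
  refine (norm_sub_le _ _).trans ?_
  have hM := (norm_Mmap_le hL Dinv hCΓ hCD hΓ hA1 hn (Gamma hL (delStar (rvec (brkConf A) V)))).trans
    (mul_le_mul_of_nonneg_left hg (by positivity))
  nlinarith

/-- `‖pwq* − 1‖ ≤ ‖w − 1‖ + ‖pq* − 1‖ = ‖w − 1‖ + ‖p − q‖` for `p, q ∈ SU(2)`: «`‖[𝕋(A⃗)](b₋)∂V(y_b)[𝕋(A⃗)](b₊)* − 1‖ ≤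
ε₁ + ‖[𝕋(A⃗)](b₋)[𝕋(A⃗)](b₊)* − 1‖`», «`‖[𝕋(A⃗)](b₋)[𝕋(A⃗)](b₊)* − 1‖ = ‖[𝕋(A⃗)](b₋) − [𝕋(A⃗)](b₊)‖`».
[cite: DybalskiStottmeisterTanimoto2024, §4.1 proof of Prop. (preserving-space)] -/
theorem norm_mul_mul_star_sub_one_le (p q : SU2) (w : ℍ) :
    ‖p.val * w * star q.val - 1‖ ≤ ‖w - 1‖ + ‖p.val - q.val‖ := by
  have e : p.val * w * star q.val - 1 = p.val * (w - 1) * star q.val + (p.val * star q.val - 1) := by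
    rw [mul_sub, sub_mul, mul_one]; abel
  rw [e, ← norm_mul_star_sub_one p.val q]
  refine (norm_add_le _ _).trans (add_le_add ?_ le_rfl)
  rw [norm_mul, norm_mul, Quaternion.norm_star, p.norm_val, q.norm_val, one_mul, mul_one]

/-- `‖[B⃗₁] − [B⃗₂]‖ ≤ |B_{1,0} − B_{2,0}| + |B⃗₁ − B⃗₂| ≤ (2τ + 1)|B⃗₁ − B⃗₂| ≤ 2|B⃗₁ − B⃗₂|` for `|B⃗ᵢ| ≤ τ ≤ 1/2`
((second-delta-estimate); the print invokes Lemma (Pauli-estimates) with `√6` instead).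
[cite: DybalskiStottmeisterTanimoto2024, §4.1 proof of Prop. (preserving-space) («by Lemma (Pauli-estimates)»); §4.5 (second-delta-estimate)] -/
theorem norm_brk_sub_brk_le {τ : ℝ} (hτ : τ ≤ 1 / 2) {B₁ B₂ : su2} (h₁ : ‖B₁‖ ≤ τ) (h₂ : ‖B₂‖ ≤ τ) :
    ‖(brk B₁).val - (brk B₂).val‖ ≤ 2 * ‖B₁ - B₂‖ := by
  have hτ0 : 0 ≤ τ := (norm_nonneg _).trans h₁
  have hB₁ : ‖B₁‖ ≤ 1 := h₁.trans (by linarith)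
  have hB₂ : ‖B₂‖ ≤ 1 := h₂.trans (by linarith)
  have e : (brk B₁).val - (brk B₂).val = ((A0 B₁ - A0 B₂ : ℝ) : ℍ) - ((B₁ - B₂ : su2) : ℍ) := by
    rw [brk_val _ hB₁, brk_val _ hB₂, Quaternion.coe_sub, Submodule.coe_sub]; abel
  rw [e]
  refine (norm_sub_le _ _).trans ?_
  rw [Quaternion.norm_coe, Real.norm_eq_abs, su2.norm_coe]
  have := abs_A0_sub_A0_le hτ B₁ B₂ h₁ h₂
  nlinarith [norm_nonneg (B₁ - B₂)]

/-- **`d₀` of a lift.** For `|B⃗(x)| ≤ τ ≤ 1/2` and `V ∈ 𝔘_{ε₁}(Ω₁)`: `d₀(B⃗, 0) = sup_b‖(∂U)(b) − 1‖ ≤ ε₁ + 4τ` for `U = [B⃗]V`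
(the chain «`≤ ε₁ + ‖[𝕋(A⃗)](b₋)[𝕋(A⃗)](b₊)* − 1‖ ≤ … ≤ C′(ε² + ε₁)`» of the proof of Prop. (preserving-space)).
[cite: DybalskiStottmeisterTanimoto2024, §4.1 proof of Prop. (preserving-space) (preserving-X)] -/
theorem d0_liftConf_le {τ ε₁ : ℝ} (hτ : τ ≤ 1 / 2) (hε₁ : 0 ≤ ε₁) {B : Site L n₁ → su2} (hB : ∀ x, ‖B x‖ ≤ τ)
    {V : CConf n₁} (hV : V ∈ smallFieldC ε₁) (b : Bond L n₁) : ‖(pd (liftConf B V) b).val - 1‖ ≤ ε₁ + 4 * τ := by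
  rw [pd_liftConf_val]
  refine (norm_mul_mul_star_sub_one_le _ _ _).trans (add_le_add (norm_pdV_sub_one_le hε₁ hV b) ?_)
  refine (norm_brk_sub_brk_le hτ (hB b.src) (hB b.tgt)).trans ?_
  have := norm_sub_le (B b.src) (B b.tgt)
  linarith [hB b.src, hB b.tgt]

/-! ## Proposition (contraction): the estimate -/

/-- **Proposition (contraction), the estimate.** «`𝕋(A⃗₁) − 𝕋(A⃗₂) = (M_{A⃗₁} − 1)(Γ∂*r⃗_{A⃗₁} − Γ∂*r⃗_{A⃗₂}) + (M_{A⃗₁} − M_{A⃗₂})Γ∂*r⃗_{A⃗₂}`»,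
«`‖(shift-one)‖ ≤ (1 + ‖M_{A⃗₁}‖)‖Γ‖96C(ε + ε₁)‖A⃗₁ − A⃗₂‖`», «`‖Γ∂*r⃗_{A⃗}‖ ≤ ‖Γ‖24C(ε² + ε₁)`» and (M-difference): with
`‖Γ‖ ≤ C_Γ`, `‖D⁻¹‖ ≤ C_D`, `‖R*‖ ≤ 2` explicit,
`‖𝕋(A⃗₁) − 𝕋(A⃗₂)‖ ≤ [(2C_ΓC_D + 1)C_Γ·96(κ + ε₁) + (4C_Γ²C_D² + 2C_ΓC_D)C_Γ·24(κ² + ε₁)]‖A⃗₁ − A⃗₂‖`.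
[cite: DybalskiStottmeisterTanimoto2024, §4.1 Prop. (contraction), proof] -/
theorem norm_Tmap_sub_le {κ ε₁ CΓ CD : ℝ} (hκ0 : 0 ≤ κ) (hκ : κ ≤ 1 / 2) (hε₁ : 0 ≤ ε₁) (hε₁' : ε₁ ≤ 1 / 2)
    (hCΓ : 0 ≤ CΓ) (hCD : 0 ≤ CD) (hΓ : ∀ f : Site L n₁ → su2, ‖Gamma hL f‖ ≤ CΓ * ‖f‖)
    {A₁ A₂ : Site L n₁ → su2} (h₁ : ∀ x, ‖A₁ x‖ ≤ κ) (h₂ : ∀ x, ‖A₂ x‖ ≤ κ)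
    (hD₁l : ∀ c, Dinv A₁ (Dop hL A₁ c) = c) (hD₂r : ∀ g, Dop hL A₂ (Dinv A₂ g) = g)
    (hn₁ : ∀ g, ‖Dinv A₁ g‖ ≤ CD * ‖g‖) (hn₂ : ∀ g, ‖Dinv A₂ g‖ ≤ CD * ‖g‖) {V : CConf n₁} (hV : V ∈ smallFieldC ε₁) :
    ‖Tmap hL Dinv V A₁ - Tmap hL Dinv V A₂‖ ≤
      ((2 * CΓ * CD + 1) * CΓ * (96 * (κ + ε₁)) + (4 * CΓ ^ 2 * CD ^ 2 + 2 * CΓ * CD) * (CΓ * (24 * (κ ^ 2 + ε₁))))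
        * ‖A₁ - A₂‖ := by
  have hA1 : ∀ x, ‖A₁ x‖ ≤ 1 := fun x => (h₁ x).trans (by linarith)
  set g₁ := Gamma hL (delStar (rvec (brkConf A₁) V)) with hg₁
  set g₂ := Gamma hL (delStar (rvec (brkConf A₂) V)) with hg₂
  have e : Tmap hL Dinv V A₁ - Tmap hL Dinv V A₂ =
      Mmap hL Dinv A₁ (g₁ - g₂) + (Mmap hL Dinv A₁ g₂ - Mmap hL Dinv A₂ g₂) - (g₁ - g₂) := by
    rw [Tmap_eq, Tmap_eq, Mmap_sub]; abel
  rw [e]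
  have hδ := norm_nonneg (A₁ - A₂)
  -- `‖g₁ − g₂‖ ≤ C_Γ·96(κ+ε₁)‖A⃗₁ − A⃗₂‖`, `‖g₂‖ ≤ C_Γ·24(κ²+ε₁)`
  have hdg : ‖g₁ - g₂‖ ≤ CΓ * (96 * (κ + ε₁) * ‖A₁ - A₂‖) := by
    rw [hg₁, hg₂, ← map_sub]
    exact (hΓ _).trans (mul_le_mul_of_nonneg_left (norm_delStar_rvec_sub_le hκ0 hκ hε₁ hε₁' h₁ h₂ hV) hCΓ)
  have hg2 : ‖g₂‖ ≤ CΓ * (24 * (κ ^ 2 + ε₁)) :=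
    (hΓ _).trans (mul_le_mul_of_nonneg_left (norm_delStar_rvec_le hκ0 hκ hε₁ hε₁' h₂ hV) hCΓ)
  have t1 : ‖Mmap hL Dinv A₁ (g₁ - g₂)‖ ≤ 2 * CΓ * CD * (CΓ * (96 * (κ + ε₁) * ‖A₁ - A₂‖)) :=
    (norm_Mmap_le hL Dinv hCΓ hCD hΓ hA1 hn₁ _).trans (mul_le_mul_of_nonneg_left hdg (by positivity))
  have t2 : ‖Mmap hL Dinv A₁ g₂ - Mmap hL Dinv A₂ g₂‖ ≤
      (4 * CΓ ^ 2 * CD ^ 2 + 2 * CΓ * CD) * ‖A₁ - A₂‖ * (CΓ * (24 * (κ ^ 2 + ε₁))) :=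
    (norm_Mmap_sub_le hL Dinv hκ hCΓ hCD hΓ h₁ h₂ hD₁l hD₂r hn₁ hn₂ g₂).trans
      (mul_le_mul_of_nonneg_left hg2 (by positivity))
  have h := norm_sub_le_of_le (norm_add_le_of_le t1 t2) hdg
  refine h.trans (le_of_eq ?_)
  ring



/-! ## `X_ε` is closed and contains `0` -/

/-- `[B⃗] = B₀ − B⃗` as a quaternion-valued (everywhere continuous) expression. [cite: DybalskiStottmeisterTanimoto2024, §4.1 (bracket-relation)] -/
def brkq (B : su2) : ℍ := ((A0 B : ℝ) : ℍ) - (B : ℍ)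

/-- [cite: DybalskiStottmeisterTanimoto2024, §4.1 (bracket-relation)] -/
theorem brk_val_eq_brkq {B : su2} (h : ‖B‖ ≤ 1) : (brk B).val = brkq B := brk_val B h

/-- `B⃗ ↦ [B⃗]` is continuous. [cite: DybalskiStottmeisterTanimoto2024, §4.1 («`X_ε` is a closed subset of `ℝ^{3n²}`»)] -/
theorem continuous_brkq : Continuous (brkq : su2 → ℍ) := by
  unfold brkq A0
  refine Continuous.sub (Quaternion.continuous_coe.comp ?_) continuous_subtype_val
  exact Real.continuous_sqrt.comp (continuous_const.sub (continuous_norm.pow 2))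

/-- «Since `X_ε` is a closed subset of `ℝ^{3n²}`, the completeness of `X_ε` in the metric `d` is clear.» (for `κ ≤ 1`).
[cite: DybalskiStottmeisterTanimoto2024, §4.1 “The metric `d`”] -/
theorem isClosed_Xeps {κ ε : ℝ} (hκ : κ ≤ 1) (V : CConf n₁) : IsClosed (Xeps L κ ε V : Set (Site L n₁ → su2)) := by
  have e : (Xeps L κ ε V : Set (Site L n₁ → su2)) =
      {A | ∀ x, ‖A x‖ ≤ κ} ∩ ({A | Q L A = 0} ∩
        {A | ∀ b : Bond L n₁, ‖brkq (A b.src) * pdV V b * star (brkq (A b.tgt)) - 1‖ ≤ ε}) := by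
    ext A
    simp only [Xeps, Set.mem_setOf_eq, Set.mem_inter_iff, smallField]
    constructor
    · rintro ⟨h1, h2, h3⟩
      refine ⟨h1, h2, fun b => ?_⟩
      have := h3 b
      rwa [pd_liftConf_val, brk_val_eq_brkq ((h1 _).trans hκ), brk_val_eq_brkq ((h1 _).trans hκ)] at this
    · rintro ⟨h1, h2, h3⟩
      refine ⟨h1, h2, fun b => ?_⟩
      rw [pd_liftConf_val, brk_val_eq_brkq ((h1 _).trans hκ), brk_val_eq_brkq ((h1 _).trans hκ)]
      exact h3 b
  rw [e]
  refine IsClosed.inter ?_ (IsClosed.inter ?_ ?_)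
  · rw [Set.setOf_forall]
    exact isClosed_iInter fun x => isClosed_le ((continuous_apply x).norm) continuous_const
  · have hQ : Continuous fun A : Site L n₁ → su2 => Q L A := by
      refine continuous_pi fun y => ?_
      simp only [Q_apply]
      exact (continuous_finsetSum (box L y)
        fun x _ => (continuous_apply x : Continuous fun A : Site L n₁ → su2 => A x)).const_smul (((L : ℝ) ^ 2)⁻¹)
    exact isClosed_eq hQ continuous_const
  · rw [Set.setOf_forall]
    refine isClosed_iInter fun b => isClosed_le ?_ continuous_const
    refine Continuous.norm (Continuous.sub ?_ continuous_const)
    exact ((continuous_brkq.comp (continuous_apply b.src)).mul continuous_const).mul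
      ((continuous_brkq.comp (continuous_apply b.tgt)).star)

/-- `0 ∈ X_ε` when `ε₁ ≤ ε` (`[0] = 1`, `d₀(0, 0) = sup_b‖∂V(y_b) − 1‖ ≤ ε₁`). [cite: DybalskiStottmeisterTanimoto2024, §4.1 (X_ε), (d₀)] -/
theorem zero_mem_Xeps {κ ε ε₁ : ℝ} (hκ : 0 ≤ κ) (hε₁ : 0 ≤ ε₁) (hε₁ε : ε₁ ≤ ε) {V : CConf n₁} (hV : V ∈ smallFieldC ε₁) :
    (0 : Site L n₁ → su2) ∈ Xeps L κ ε V := by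
  refine ⟨fun x => by rw [Pi.zero_apply, norm_zero]; exact hκ, ?_, fun b => ?_⟩
  · funext y; simp [Q_apply]
  · have h := d0_liftConf_le (τ := 0) (by norm_num) hε₁ (B := (0 : Site L n₁ → su2))
      (fun x => by rw [Pi.zero_apply, norm_zero]) hV b
    linarith

/-! ## Propositions (preserving-space), (contraction) and the fixed point -/

section FixedPoint

variable (hL : 0 < L) (Dinv : (Site L n₁ → su2) → ((CSite n₁ → su2) →ₗ[ℝ] (CSite n₁ → su2)))

/-- **Proposition (preserving-space).** «For `ε₁ ≤ ε²`, sufficiently small (uniformly in `n`), `𝕋` maps `X_ε` into itself.»  Here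
with the smallness spelled out: `κ := 4c·L·ε ≤ 1/2`, `κ ≤ κ₀` (domain of Lemma (Q-G-R-Q-lemma)), `ε₁ ≤ 1/2`,
`τ := C_Γ(2C_ΓC_D + 1)·24(κ² + ε₁) ≤ κ` and `ε₁ + 4τ ≤ ε`.
[cite: DybalskiStottmeisterTanimoto2024, §4.1 Prop. (preserving-space)] -/
theorem Tmap_mem_Xeps {ε ε₁ κ₀ CΓ CD : ℝ} (hκ : 4 * ch * L * ε ≤ 1 / 2) (hκ₀ : 4 * ch * L * ε ≤ κ₀)
    (hε₁ : 0 ≤ ε₁) (hε₁' : ε₁ ≤ 1 / 2) (hCΓ : 0 ≤ CΓ) (hCD : 0 ≤ CD)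
    (hΓ : ∀ f : Site L n₁ → su2, ‖Gamma hL f‖ ≤ CΓ * ‖f‖)
    (hD : ∀ A : Site L n₁ → su2, (∀ x, ‖A x‖ ≤ κ₀) →
      (∀ c, Dinv A (Dop hL A c) = c) ∧ (∀ g, Dop hL A (Dinv A g) = g) ∧ ∀ g, ‖Dinv A g‖ ≤ CD * ‖g‖)
    (hamp : CΓ * (2 * CΓ * CD + 1) * (24 * ((4 * ch * L * ε) ^ 2 + ε₁)) ≤ 4 * ch * L * ε)
    (hd0 : ε₁ + 4 * (CΓ * (2 * CΓ * CD + 1) * (24 * ((4 * ch * L * ε) ^ 2 + ε₁))) ≤ ε)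
    {V : CConf n₁} (hV : V ∈ smallFieldC ε₁) {A : Site L n₁ → su2} (hA : A ∈ Xeps L (4 * ch * L * ε) ε V) :
    Tmap hL Dinv V A ∈ Xeps L (4 * ch * L * ε) ε V := by
  have hκ0 : 0 ≤ 4 * ch * L * ε := by
    have hτ0 : 0 ≤ CΓ * (2 * CΓ * CD + 1) * (24 * ((4 * ch * L * ε) ^ 2 + ε₁)) := by positivity
    exact hτ0.trans hamp
  obtain ⟨-, hDr, hDn⟩ := hD A fun x => (hA.1 x).trans hκ₀
  have hT := norm_Tmap_le hL Dinv hκ0 hκ hε₁ hε₁' hCΓ hCD hΓ hA.1 hDn hV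
  have hTx : ∀ x, ‖Tmap hL Dinv V A x‖ ≤ CΓ * (2 * CΓ * CD + 1) * (24 * ((4 * ch * L * ε) ^ 2 + ε₁)) :=
    fun x => (norm_le_pi_norm _ x).trans hT
  exact ⟨fun x => (hTx x).trans hamp, Q_Tmap hL Dinv hDr V, fun b => (d0_liftConf_le (hamp.trans hκ) hε₁ hTx hV b).trans hd0⟩

/-- **Theorem (main-theorem-intext), fixed-point form.** «for `ε, ε₁` sufficiently small (uniformly in `n`) there is a unique solution
`A⃗ ∈ X_ε` of the equation `𝕋(A⃗) = A⃗`» — by Theorem (Banach) on the closed set `X_ε ∋ 0` with contraction rate `q ≤ 1/2`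
(Propositions (preserving-space), (contraction)). [cite: DybalskiStottmeisterTanimoto2024, §4.1 Theorem (main-theorem-intext); Theorem (Banach)] -/
theorem existsUnique_fixedPoint {ε ε₁ κ₀ CΓ CD : ℝ} (hκ : 4 * ch * L * ε ≤ 1 / 2) (hκ₀ : 4 * ch * L * ε ≤ κ₀)
    (hε₁ : 0 ≤ ε₁) (hε₁' : ε₁ ≤ 1 / 2) (hε₁ε : ε₁ ≤ ε) (hCΓ : 0 ≤ CΓ) (hCD : 0 ≤ CD)
    (hΓ : ∀ f : Site L n₁ → su2, ‖Gamma hL f‖ ≤ CΓ * ‖f‖)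
    (hD : ∀ A : Site L n₁ → su2, (∀ x, ‖A x‖ ≤ κ₀) →
      (∀ c, Dinv A (Dop hL A c) = c) ∧ (∀ g, Dop hL A (Dinv A g) = g) ∧ ∀ g, ‖Dinv A g‖ ≤ CD * ‖g‖)
    (hamp : CΓ * (2 * CΓ * CD + 1) * (24 * ((4 * ch * L * ε) ^ 2 + ε₁)) ≤ 4 * ch * L * ε)
    (hd0 : ε₁ + 4 * (CΓ * (2 * CΓ * CD + 1) * (24 * ((4 * ch * L * ε) ^ 2 + ε₁))) ≤ ε)
    (hq : (2 * CΓ * CD + 1) * CΓ * (96 * (4 * ch * L * ε + ε₁))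
      + (4 * CΓ ^ 2 * CD ^ 2 + 2 * CΓ * CD) * (CΓ * (24 * ((4 * ch * L * ε) ^ 2 + ε₁))) ≤ 1 / 2)
    {V : CConf n₁} (hV : V ∈ smallFieldC ε₁) :
    ∃! A : Site L n₁ → su2, A ∈ Xeps L (4 * ch * L * ε) ε V ∧ Tmap hL Dinv V A = A := by
  have hκ0 : 0 ≤ 4 * ch * L * ε := by
    have hτ0 : 0 ≤ CΓ * (2 * CΓ * CD + 1) * (24 * ((4 * ch * L * ε) ^ 2 + ε₁)) := by positivity
    exact hτ0.trans hamp
  set X : Set (Site L n₁ → su2) := Xeps L (4 * ch * L * ε) ε V with hX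
  have hmaps : Set.MapsTo (Tmap hL Dinv V) X X :=
    fun A hA => Tmap_mem_Xeps hL Dinv hκ hκ₀ hε₁ hε₁' hCΓ hCD hΓ hD hamp hd0 hV hA
  have hlip : ∀ A ∈ X, ∀ B ∈ X, ‖Tmap hL Dinv V A - Tmap hL Dinv V B‖ ≤ 1 / 2 * ‖A - B‖ := by
    intro A hA B hB
    obtain ⟨hAl, -, hAn⟩ := hD A fun x => (hA.1 x).trans hκ₀
    obtain ⟨-, hBr, hBn⟩ := hD B fun x => (hB.1 x).trans hκ₀
    exact (norm_Tmap_sub_le hL Dinv hκ0 hκ hε₁ hε₁' hCΓ hCD hΓ hA.1 hB.1 hAl hBr hAn hBn hV).trans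
      (mul_le_mul_of_nonneg_right hq (norm_nonneg _))
  haveI : CompleteSpace su2 := FiniteDimensional.complete ℝ su2
  have hc : IsComplete X := (isClosed_Xeps (hκ.trans (by norm_num)) V).isComplete
  have hK : ContractingWith (1 / 2 : ℝ≥0) (hmaps.restrict (Tmap hL Dinv V) X X) := by
    refine ⟨by norm_num, LipschitzWith.of_dist_le_mul fun a b => ?_⟩
    rw [Subtype.dist_eq, Subtype.dist_eq, dist_eq_norm, dist_eq_norm, Set.MapsTo.val_restrict_apply,
      Set.MapsTo.val_restrict_apply]
    push_cast
    exact hlip a a.2 b b.2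
  obtain ⟨A, hAX, hfix, -, -⟩ := hK.exists_fixedPoint' hc hmaps (zero_mem_Xeps hκ0 hε₁ hε₁ε hV) (edist_ne_top _ _)
  refine ⟨A, ⟨hAX, hfix.eq⟩, fun B hB => ?_⟩
  have h := hlip B hB.1 A hAX
  rw [hB.2, hfix.eq] at h
  have h0 : ‖B - A‖ = 0 := le_antisymm (by nlinarith [norm_nonneg (B - A)]) (norm_nonneg _)
  exact sub_eq_zero.mp (norm_eq_zero.mp h0)

/-- **Theorem (main-theorem-intext).** «Consequently, there exists a unique critical point of the action (action-one-x) with the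
constraint (constraint) over the set `𝔘_ε`» — the fixed point `A⃗* ∈ X_ε` gives `U = [A⃗*]V`, and any constrained critical `U ∈ 𝔘_ε(Ω)`
gives a fixed point `A⃗(U′) ∈ X_ε` (equality of configuration spaces + Theorem (critical-point-equation)).
[cite: DybalskiStottmeisterTanimoto2024, §4.1 Theorem (main-theorem-intext)] -/
theorem existsUnique_critical {ε ε₁ κ₀ CΓ CD : ℝ} (hε : 0 < ε) (hκ : 4 * ch * L * ε ≤ 1 / 2) (hκ₀ : 4 * ch * L * ε ≤ κ₀)
    (hε₁ : 0 ≤ ε₁) (hε₁' : ε₁ ≤ 1 / 2) (hε₁ε : ε₁ ≤ ε) (hCΓ : 0 ≤ CΓ) (hCD : 0 ≤ CD)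
    (hΓ : ∀ f : Site L n₁ → su2, ‖Gamma hL f‖ ≤ CΓ * ‖f‖)
    (hD : ∀ A : Site L n₁ → su2, (∀ x, ‖A x‖ ≤ κ₀) →
      (∀ c, Dinv A (Dop hL A c) = c) ∧ (∀ g, Dop hL A (Dinv A g) = g) ∧ ∀ g, ‖Dinv A g‖ ≤ CD * ‖g‖)
    (hamp : CΓ * (2 * CΓ * CD + 1) * (24 * ((4 * ch * L * ε) ^ 2 + ε₁)) ≤ 4 * ch * L * ε)
    (hd0 : ε₁ + 4 * (CΓ * (2 * CΓ * CD + 1) * (24 * ((4 * ch * L * ε) ^ 2 + ε₁))) ≤ ε)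
    (hq : (2 * CΓ * CD + 1) * CΓ * (96 * (4 * ch * L * ε + ε₁))
      + (4 * CΓ ^ 2 * CD ^ 2 + 2 * CΓ * CD) * (CΓ * (24 * ((4 * ch * L * ε) ^ 2 + ε₁))) ≤ 1 / 2)
    {V : CConf n₁} (hV : V ∈ smallFieldC ε₁) :
    ∃! U : Conf L n₁, U ∈ smallField ε ∧ IsConstrainedCritical V U := by
  have h1 : 4 * ch * L * ε < 1 := by linarith
  obtain ⟨A, ⟨hAX, hfix⟩, huniq⟩ :=
    existsUnique_fixedPoint hL Dinv hκ hκ₀ hε₁ hε₁' hε₁ε hCΓ hCD hΓ hD hamp hd0 hq hV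
  obtain ⟨hAl, hAr, -⟩ := hD A fun x => (hAX.1 x).trans hκ₀
  refine ⟨liftConf A V, ⟨liftConf_mem_smallField hAX, (Tmap_eq_self_iff hL Dinv hε h1 hAX hAl hAr).mp hfix⟩, ?_⟩
  rintro U ⟨hU, hcrit⟩
  have hC : avg U = V := hcrit.1
  have hBX : Avec (Uprime U V) ∈ Xeps L (4 * ch * L * ε) ε V := Avec_Uprime_mem_Xeps hL hε h1.le hU hC
  have hlift : liftConf (Avec (Uprime U V)) V = U := liftConf_Avec_Uprime hL hε h1.le hU hC
  obtain ⟨hBl, hBr, -⟩ := hD (Avec (Uprime U V)) fun x => (hBX.1 x).trans hκ₀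
  have hBfix : Tmap hL Dinv V (Avec (Uprime U V)) = Avec (Uprime U V) :=
    (Tmap_eq_self_iff hL Dinv hε h1 hBX hBl hBr).mpr (by rw [hlift]; exact hcrit)
  rw [← hlift, huniq _ ⟨hBX, hBfix⟩]

end FixedPoint

/-! ## «for `ε, ε₁` sufficiently small (uniformly in `n`)»: an explicit choice, and Theorem 1 -/

/-- The explicit smallness: given `κ₁ = 4c·L ≥ 8`, the domain radius `κ₀ > 0` of Lemma (Q-G-R-Q-lemma) and the non-negative
constants `K₁, K₂, K₃` built from `C_Γ, C_D`, there is `ε > 0` with `ε₁ := ε²` satisfying every side condition of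
Propositions (preserving-space), (contraction). [cite: DybalskiStottmeisterTanimoto2024, §4.1 («for `ε, ε₁` sufficiently small (uniformly in `n`)», «`ε₁ ≤ ε²`»)] -/
theorem eps_choice {κ₁ κ₀ K₁ K₂ K₃ : ℝ} (hκ₁ : 8 ≤ κ₁) (hκ₀ : 0 < κ₀) (hK₁ : 0 ≤ K₁) (hK₂ : 0 ≤ K₂) (hK₃ : 0 ≤ K₃) :
    ∃ ε : ℝ, 0 < ε ∧ ε ≤ 1 / 16 ∧ κ₁ * ε ≤ 1 / 2 ∧ κ₁ * ε ≤ κ₀ ∧ K₁ * ((κ₁ * ε) ^ 2 + ε ^ 2) ≤ κ₁ * ε ∧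
      ε ^ 2 + 4 * (K₁ * ((κ₁ * ε) ^ 2 + ε ^ 2)) ≤ ε ∧ K₂ * (κ₁ * ε + ε ^ 2) + K₃ * ((κ₁ * ε) ^ 2 + ε ^ 2) ≤ 1 / 2 := by
  have hκ₁0 : 0 < κ₁ := by linarith
  set S := K₂ * (κ₁ + 1) + K₃ * (κ₁ ^ 2 + 1) with hS
  have hS0 : 0 ≤ S := by positivity
  set ε := min (1 / (2 * κ₁)) (min (κ₀ / κ₁) (min (κ₁ / (K₁ * (κ₁ ^ 2 + 1) + 1))
    (min (1 / (1 + 4 * K₁ * (κ₁ ^ 2 + 1))) (1 / (2 * S + 1))))) with hε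
  have hε0 : 0 < ε := by positivity
  have h1 : ε ≤ 1 / (2 * κ₁) := min_le_left _ _
  have h2 : ε ≤ κ₀ / κ₁ := (min_le_right _ _).trans (min_le_left _ _)
  have h3 : ε ≤ κ₁ / (K₁ * (κ₁ ^ 2 + 1) + 1) := ((min_le_right _ _).trans (min_le_right _ _)).trans (min_le_left _ _)
  have h4 : ε ≤ 1 / (1 + 4 * K₁ * (κ₁ ^ 2 + 1)) :=
    (((min_le_right _ _).trans (min_le_right _ _)).trans (min_le_right _ _)).trans (min_le_left _ _)
  have h5 : ε ≤ 1 / (2 * S + 1) :=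
    (((min_le_right _ _).trans (min_le_right _ _)).trans (min_le_right _ _)).trans (min_le_right _ _)
  have hε16 : ε ≤ 1 / 16 := h1.trans (one_div_le_one_div_of_le (by norm_num) (by linarith))
  have hε1 : ε ≤ 1 := by linarith
  have hεsq : ε ^ 2 ≤ ε := by nlinarith
  refine ⟨ε, hε0, hε16, ?_, ?_, ?_, ?_, ?_⟩
  · calc κ₁ * ε ≤ κ₁ * (1 / (2 * κ₁)) := mul_le_mul_of_nonneg_left h1 hκ₁0.le
      _ = 1 / 2 := by field_simp
  · rw [mul_comm]; exact (le_div_iff₀ hκ₁0).mp h2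
  · have h3' : ε * (K₁ * (κ₁ ^ 2 + 1) + 1) ≤ κ₁ := (le_div_iff₀ (by positivity)).mp h3
    have h3'' : K₁ * (κ₁ ^ 2 + 1) * ε ≤ κ₁ := by nlinarith
    have := mul_le_mul_of_nonneg_right h3'' hε0.le
    nlinarith
  · have h4' : ε * (1 + 4 * K₁ * (κ₁ ^ 2 + 1)) ≤ 1 := (le_div_iff₀ (by positivity)).mp h4
    have := mul_le_mul_of_nonneg_right h4' hε0.le
    nlinarith
  · have h5' : ε * (2 * S + 1) ≤ 1 := (le_div_iff₀ (by positivity)).mp h5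
    have hSε : S * ε ≤ 1 / 2 := by nlinarith
    have hb1 : K₂ * (κ₁ * ε + ε ^ 2) ≤ K₂ * (κ₁ + 1) * ε := by nlinarith [mul_le_mul_of_nonneg_left hεsq hK₂]
    have hb2 : K₃ * ((κ₁ * ε) ^ 2 + ε ^ 2) ≤ K₃ * (κ₁ ^ 2 + 1) * ε := by
      have h' : (κ₁ * ε) ^ 2 ≤ κ₁ ^ 2 * ε := by nlinarith [mul_le_mul_of_nonneg_left hεsq (sq_nonneg κ₁)]
      nlinarith [mul_le_mul_of_nonneg_left hεsq hK₃, mul_le_mul_of_nonneg_left h' hK₃]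
    calc K₂ * (κ₁ * ε + ε ^ 2) + K₃ * ((κ₁ * ε) ^ 2 + ε ^ 2) ≤ K₂ * (κ₁ + 1) * ε + K₃ * (κ₁ ^ 2 + 1) * ε := add_le_add hb1 hb2
      _ = S * ε := by rw [hS]; ring
      _ ≤ 1 / 2 := hSε

/-- **Theorem (main-theorem-intext) = Theorem 1 from the `𝓛^∞` inputs.**  Assume, for the fixed `L`, uniformly in `n₁`:
Lemma (infty-bounds) for `Γ` («`‖Γ‖_{∞,∞;Ω} ≤ C`»: `hΓ`) and Lemma (Q-G-R-Q-lemma) («`D_{A⃗} := QΓR*_{A⃗}Q*` satisfies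
`‖D_{A⃗}⁻¹‖_{∞,∞;Ω} ≤ C` for all `A⃗ ∈ Conf⃗^{κ₀}(Ω)`, `κ₀ > 0` sufficiently small»: the two-sided inverse `Dinv A⃗` with its bound, `hD`).
Then «for `ε, ε₁` sufficiently small (uniformly in `n`) … there exists a unique critical point of the action (action-one-x) with the
constraint (constraint) over the set `𝔘_ε`», i.e. `Theorem1 L` (with `ε₁ = ε²`). [cite: DybalskiStottmeisterTanimoto2024, §1.1 Theorem (main-theorem); §4.1 Theorem (main-theorem-intext); §4.3 Lemma (infty-bounds); §4.4 Lemma (Q-G-R-Q-lemma)] -/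
theorem theorem1_of_Linfty_bounds (hL : 0 < L) {CΓ CD κ₀ : ℝ} (hκ₀ : 0 < κ₀)
    (hΓ : ∀ {n₁ : ℕ} (f : Site L n₁ → su2), ‖Gamma hL f‖ ≤ CΓ * ‖f‖)
    (Dinv : ∀ {n₁ : ℕ}, (Site L n₁ → su2) → ((CSite n₁ → su2) →ₗ[ℝ] (CSite n₁ → su2)))
    (hD : ∀ {n₁ : ℕ} (A : Site L n₁ → su2), (∀ x, ‖A x‖ ≤ κ₀) →
      (∀ c, Dinv A (Dop hL A c) = c) ∧ (∀ g, Dop hL A (Dinv A g) = g) ∧ ∀ g, ‖Dinv A g‖ ≤ CD * ‖g‖) :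
    Theorem1 L := by
  intro _hodd hL1
  -- non-negative versions of the constants
  have hΓ' : ∀ {n₁ : ℕ} (f : Site L n₁ → su2), ‖Gamma hL f‖ ≤ max CΓ 0 * ‖f‖ :=
    fun f => (hΓ f).trans (mul_le_mul_of_nonneg_right (le_max_left _ _) (norm_nonneg _))
  have hD' : ∀ {n₁ : ℕ} (A : Site L n₁ → su2), (∀ x, ‖A x‖ ≤ κ₀) →
      (∀ c, Dinv A (Dop hL A c) = c) ∧ (∀ g, Dop hL A (Dinv A g) = g) ∧ ∀ g, ‖Dinv A g‖ ≤ max CD 0 * ‖g‖ := by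
    intro n₁ A hA
    obtain ⟨h1, h2, h3⟩ := hD A hA
    exact ⟨h1, h2, fun g => (h3 g).trans (mul_le_mul_of_nonneg_right (le_max_left _ _) (norm_nonneg _))⟩
  set CΓ' := max CΓ 0 with hCΓ'
  set CD' := max CD 0 with hCD'
  have hCΓ0 : 0 ≤ CΓ' := le_max_right _ _
  have hCD0 : 0 ≤ CD' := le_max_right _ _
  -- the constants of Propositions (preserving-space), (contraction)
  have hLr : (2 : ℝ) ≤ L := by exact_mod_cast hL1
  have hκ₁ : 8 ≤ 4 * ch * (L : ℝ) := by nlinarith [one_le_ch]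
  obtain ⟨ε, hε0, hε16, hκ, hκκ₀, hamp, hd0, hq⟩ := eps_choice (κ₀ := κ₀) (K₁ := CΓ' * (2 * CΓ' * CD' + 1) * 24)
    (K₂ := (2 * CΓ' * CD' + 1) * CΓ' * 96) (K₃ := (4 * CΓ' ^ 2 * CD' ^ 2 + 2 * CΓ' * CD') * CΓ' * 24) hκ₁ hκ₀
    (by positivity) (by positivity) (by positivity)
  refine ⟨ε, ε ^ 2, hε0, by linarith, by positivity, by nlinarith, fun n₁ V hV => ?_⟩
  refine existsUnique_critical hL Dinv (κ₀ := κ₀) (CΓ := CΓ') (CD := CD') hε0 ?_ ?_ (by positivity) (by nlinarith)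
    (by nlinarith) hCΓ0 hCD0 hΓ' hD' ?_ ?_ ?_ hV
  · simpa only [mul_assoc] using hκ
  · simpa only [mul_assoc] using hκκ₀
  · have := hamp; ring_nf at this ⊢; linarith
  · have := hd0; ring_nf at this ⊢; linarith
  · have := hq; ring_nf at this ⊢; linarith



/-! ## (dRA): `‖δR*_{A⃗}‖ ≤ 2ε` -/

/-- `1 − A₀ ≤ |A⃗|` for `|A⃗| ≤ 1` (`A₀ = √(1 − |A⃗|²) ≥ 1 − |A⃗|²  ≥ 1 − |A⃗|`). [cite: DybalskiStottmeisterTanimoto2024, §4.4 proof of Lemma (Q-G-R-Q-lemma) («the relation `A₀(x) = √(1 − |A⃗(x)|²)`»)] -/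
theorem one_sub_A0_le (A : su2) (hA : ‖A‖ ≤ 1) : 1 - A0 A ≤ ‖A‖ := by
  have h0 := norm_nonneg A
  have hsq : A0 A ^ 2 = 1 - ‖A‖ ^ 2 := Real.sq_sqrt (by nlinarith)
  have hA0 := A0_nonneg A
  -- `(1 − |A|)² ≤ 1 − |A|² = A₀²` since `|A| ≤ 1`
  nlinarith [A0_le_one A]

/-- **(dRA)** pointwise: «`δR*_{A⃗}(x)v⃗ = (A₀(x) − 1)v⃗ − A⃗(x) × v⃗`», `|δR*_{A⃗}(x)v⃗| ≤ (|A₀(x) − 1| + |A⃗(x)|)|v⃗| ≤ 2|A⃗(x)||v⃗|`.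
[cite: DybalskiStottmeisterTanimoto2024, §4.4 proof of Lemma (Q-G-R-Q-lemma) (dRA)] -/
theorem norm_Rstar_sub_self_le (A : su2) (hA : ‖A‖ ≤ 1) (v : su2) : ‖Rstar A v - v‖ ≤ 2 * ‖A‖ * ‖v‖ := by
  have e : Rstar A v - v = (A0 A - 1) • v - crossLin A v := by
    apply Subtype.ext
    simp only [Rstar_coe, Submodule.coe_sub, Submodule.coe_smul, crossLin_coe, sub_smul, one_smul]
    abel
  rw [e]
  calc ‖(A0 A - 1) • v - crossLin A v‖ ≤ ‖(A0 A - 1) • v‖ + ‖crossLin A v‖ := norm_sub_le _ _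
    _ ≤ ‖A‖ * ‖v‖ + ‖A‖ * ‖v‖ := by
        refine add_le_add ?_ (DST24RstarBounds.norm_crossLin_le A v)
        rw [norm_smul, Real.norm_eq_abs, abs_sub_comm, abs_of_nonneg (by linarith [A0_le_one A])]
        exact mul_le_mul_of_nonneg_right (one_sub_A0_le A hA) (norm_nonneg _)
    _ = 2 * ‖A‖ * ‖v‖ := by ring

/-- **(dRA)** as an operator bound: `‖R*_{A⃗}f − f‖_{∞;Ω} ≤ 2κ‖f‖_{∞;Ω}` for `|A⃗(x)| ≤ κ ≤ 1`.
[cite: DybalskiStottmeisterTanimoto2024, §4.4 proof of Lemma (Q-G-R-Q-lemma) (dRA) («`≤ 2ε`»)] -/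
theorem norm_RstarOp_sub_self_le {κ : ℝ} (hκ0 : 0 ≤ κ) (hκ : κ ≤ 1) {A : Site L n₁ → su2} (hA : ∀ x, ‖A x‖ ≤ κ)
    (f : Site L n₁ → su2) : ‖RstarOp A f - f‖ ≤ 2 * κ * ‖f‖ := by
  refine (pi_norm_le_iff_of_nonneg (by positivity)).mpr fun x => ?_
  rw [Pi.sub_apply, RstarOp_apply]
  calc ‖Rstar (A x) (f x) - f x‖ ≤ 2 * ‖A x‖ * ‖f x‖ := norm_Rstar_sub_self_le _ ((hA x).trans hκ) _
    _ ≤ 2 * κ * ‖f‖ :=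
        mul_le_mul (mul_le_mul_of_nonneg_left (hA x) (by norm_num)) (norm_le_pi_norm f x) (norm_nonneg _) (by positivity)

/-! ## `D_{A⃗} = (QΓQ*)(1 + (QΓQ*)⁻¹QΓδR*_{A⃗}Q*)` and its inverse -/

/-- «`QΓR*_{A⃗}Q* = (QΓQ*)(1 + (QΓQ*)⁻¹QΓδR*_{A⃗}Q*)`»: `D_{A⃗}c = QΓQ*c + QΓδR*_{A⃗}Q*c`.
[cite: DybalskiStottmeisterTanimoto2024, §4.4 proof of Lemma (Q-G-R-Q-lemma) (resolvent-equation-one)] -/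
theorem Dop_eq (hL : 0 < L) (A : Site L n₁ → su2) (c : CSite n₁ → su2) :
    Dop hL A c = QGammaQstar hL c + Q L (Gamma hL (RstarOp A (Qstar L c) - Qstar L c)) := by
  rw [Dop_apply, QGammaQstar_apply, ← Q_add, ← map_add, add_sub_cancel]

/-- The perturbation `S_{A⃗} := (QΓQ*)⁻¹QΓδR*_{A⃗}Q*`. [cite: DybalskiStottmeisterTanimoto2024, §4.4 proof of Lemma (Q-G-R-Q-lemma)] -/
def pert (hL : 0 < L) (A : Site L n₁ → su2) (c : CSite n₁ → su2) : CSite n₁ → su2 :=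
  (QGammaQstar hL).symm (Q L (Gamma hL (RstarOp A (Qstar L c) - Qstar L c)))

/-- `D_{A⃗}c = (QΓQ*)(c + S_{A⃗}c)`. [cite: DybalskiStottmeisterTanimoto2024, §4.4 proof of Lemma (Q-G-R-Q-lemma) (resolvent-equation-one)] -/
theorem Dop_eq_pert (hL : 0 < L) (A : Site L n₁ → su2) (c : CSite n₁ → su2) :
    Dop hL A c = QGammaQstar hL (c + pert hL A c) := by
  rw [map_add, pert, LinearEquiv.apply_symm_apply, Dop_eq]

/-- «`‖(QΓQ*)⁻¹QΓδR*_{A⃗}Q*‖ ≤ ‖(QΓQ*)⁻¹‖‖QΓδR*_{A⃗}Q*‖`» `≤ C_Q·C_Γ·2κ` ((Neumann-condition), (dRA)).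
[cite: DybalskiStottmeisterTanimoto2024, §4.4 proof of Lemma (Q-G-R-Q-lemma) (Neumann-condition)] -/
theorem norm_pert_le (hL : 0 < L) {κ CΓ CQ : ℝ} (hκ0 : 0 ≤ κ) (hκ : κ ≤ 1) (hCΓ : 0 ≤ CΓ) (hCQ : 0 ≤ CQ)
    (hΓ : ∀ f : Site L n₁ → su2, ‖Gamma hL f‖ ≤ CΓ * ‖f‖)
    (hQ : ∀ g : CSite n₁ → su2, ‖(QGammaQstar hL).symm g‖ ≤ CQ * ‖g‖) {A : Site L n₁ → su2} (hA : ∀ x, ‖A x‖ ≤ κ)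
    (c : CSite n₁ → su2) : ‖pert hL A c‖ ≤ 2 * CQ * CΓ * κ * ‖c‖ := by
  unfold pert
  calc _ ≤ CQ * ‖Q L (Gamma hL (RstarOp A (Qstar L c) - Qstar L c))‖ := hQ _
    _ ≤ CQ * ‖Gamma hL (RstarOp A (Qstar L c) - Qstar L c)‖ := mul_le_mul_of_nonneg_left (norm_Q_le hL _) hCQ
    _ ≤ CQ * (CΓ * ‖RstarOp A (Qstar L c) - Qstar L c‖) := mul_le_mul_of_nonneg_left (hΓ _) hCQ
    _ ≤ CQ * (CΓ * (2 * κ * ‖Qstar L c‖)) :=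
        mul_le_mul_of_nonneg_left (mul_le_mul_of_nonneg_left (norm_RstarOp_sub_self_le hκ0 hκ hA _) hCΓ) hCQ
    _ ≤ CQ * (CΓ * (2 * κ * ‖c‖)) :=
        mul_le_mul_of_nonneg_left (mul_le_mul_of_nonneg_left
          (mul_le_mul_of_nonneg_left (norm_Qstar_le c) (by positivity)) hCΓ) hCQ
    _ = 2 * CQ * CΓ * κ * ‖c‖ := by ring

/-- «The second factor is invertible provided that `‖(QΓQ*)⁻¹QΓδR*_{A⃗}Q*‖ < 1`»: in finite dimensions, `‖S_{A⃗}c‖ ≤ ½‖c‖` makes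
`D_{A⃗}` injective. [cite: DybalskiStottmeisterTanimoto2024, §4.4 proof of Lemma (Q-G-R-Q-lemma) (Neumann-condition)] -/
theorem Dop_injective (hL : 0 < L) {A : Site L n₁ → su2} (hS : ∀ c, ‖pert hL A c‖ ≤ 1 / 2 * ‖c‖) :
    Function.Injective (Dop hL A) := by
  intro c c' h
  have h' : c + pert hL A c = c' + pert hL A c' := by
    rw [Dop_eq_pert, Dop_eq_pert] at h
    exact (QGammaQstar hL).injective h
  have hp : pert hL A c - pert hL A c' = pert hL A (c - c') := by
    simp only [pert, ← map_sub, Qstar_sub, RstarOp_sub, ← Q_sub]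
    congr 2; abel
  have hd : c - c' = -(pert hL A (c - c')) := by
    rw [← hp]
    -- `c − c' = pert c' − pert c`
    linear_combination (norm := abel_nf) h'
  have e1 : ‖c - c'‖ = ‖pert hL A (c - c')‖ := by
    conv_lhs => rw [hd]
    rw [norm_neg]
  have hn : ‖c - c'‖ ≤ 1 / 2 * ‖c - c'‖ :=
    calc ‖c - c'‖ = ‖pert hL A (c - c')‖ := e1
      _ ≤ 1 / 2 * ‖c - c'‖ := hS _
  have : ‖c - c'‖ = 0 := le_antisymm (by linarith [norm_nonneg (c - c')]) (norm_nonneg _)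
  exact sub_eq_zero.mp (norm_eq_zero.mp this)

/-- The inverse family `A⃗ ↦ D_{A⃗}⁻¹` (set to `0` where `D_{A⃗}` is not injective; never used there).
[cite: DybalskiStottmeisterTanimoto2024, §4.4 Lemma (Q-G-R-Q-lemma) («is invertible»)] -/
def DinvStd (hL : 0 < L) (A : Site L n₁ → su2) : (CSite n₁ → su2) →ₗ[ℝ] (CSite n₁ → su2) :=
  open Classical in
  if h : Function.Injective (Dop hL A) then ((LinearEquiv.ofInjectiveEndo (Dop hL A) h).symm : _ →ₗ[ℝ] _) else 0

/-- [cite: DybalskiStottmeisterTanimoto2024, §4.4 Lemma (Q-G-R-Q-lemma)] -/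
theorem DinvStd_Dop (hL : 0 < L) {A : Site L n₁ → su2} (h : Function.Injective (Dop hL A)) (c : CSite n₁ → su2) :
    DinvStd hL A (Dop hL A c) = c := by
  rw [DinvStd, dif_pos h]
  exact (LinearEquiv.ofInjectiveEndo (Dop hL A) h).symm_apply_apply c

/-- [cite: DybalskiStottmeisterTanimoto2024, §4.4 Lemma (Q-G-R-Q-lemma)] -/
theorem Dop_DinvStd (hL : 0 < L) {A : Site L n₁ → su2} (h : Function.Injective (Dop hL A)) (g : CSite n₁ → su2) :
    Dop hL A (DinvStd hL A g) = g := by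
  rw [DinvStd, dif_pos h]
  exact (LinearEquiv.ofInjectiveEndo (Dop hL A) h).apply_symm_apply g

/-- **Lemma (Q-G-R-Q-lemma).** «The operator `D_{A⃗} := QΓR*_{A⃗}Q*` is invertible and the following estimate holds true for
`A⃗ ∈ Conf⃗^ε(Ω)`, `δ = 1` and some constant `C` independent of `n` and `ε`: `‖(QΓR*_{A⃗}Q*)⁻¹‖_{∞,∞;Ω₁} ≤ C`, provided that `0 < ε ≤ 1`
sufficiently small (uniformly in `n`).»  Here from the constants of Lemma (infty-bounds) (`‖Γ‖ ≤ C_Γ`, `‖(QΓQ*)⁻¹‖ ≤ C_Q`): for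
`|A⃗(x)| ≤ κ₀ := 1/(4C_QC_Γ + 4)` the inverse exists with `‖D_{A⃗}⁻¹‖ ≤ 2C_Q` («`≤ C″/(1 − C′ε) ≤ 2C″`»).
[cite: DybalskiStottmeisterTanimoto2024, §4.4 Lemma (Q-G-R-Q-lemma)] -/
theorem QGRQ_lemma (hL : 0 < L) {CΓ CQ : ℝ} (hCΓ : 0 ≤ CΓ) (hCQ : 0 ≤ CQ)
    (hΓ : ∀ f : Site L n₁ → su2, ‖Gamma hL f‖ ≤ CΓ * ‖f‖)
    (hQ : ∀ g : CSite n₁ → su2, ‖(QGammaQstar hL).symm g‖ ≤ CQ * ‖g‖) {A : Site L n₁ → su2}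
    (hA : ∀ x, ‖A x‖ ≤ 1 / (4 * CQ * CΓ + 4)) :
    (∀ c, DinvStd hL A (Dop hL A c) = c) ∧ (∀ g, Dop hL A (DinvStd hL A g) = g) ∧ ∀ g, ‖DinvStd hL A g‖ ≤ 2 * CQ * ‖g‖ := by
  have hκ0 : (0 : ℝ) ≤ 1 / (4 * CQ * CΓ + 4) := by positivity
  have hκ1 : 1 / (4 * CQ * CΓ + 4) ≤ 1 := by
    rw [div_le_iff₀ (by positivity)]; nlinarith [mul_nonneg hCQ hCΓ]
  have hq : 2 * CQ * CΓ * (1 / (4 * CQ * CΓ + 4)) ≤ 1 / 2 := by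
    rw [mul_one_div, div_le_iff₀ (by positivity)]; nlinarith [mul_nonneg hCQ hCΓ]
  have hS : ∀ c, ‖pert hL A c‖ ≤ 1 / 2 * ‖c‖ := fun c =>
    (norm_pert_le hL hκ0 hκ1 hCΓ hCQ hΓ hQ hA c).trans (mul_le_mul_of_nonneg_right hq (norm_nonneg _))
  have hinj := Dop_injective hL hS
  refine ⟨DinvStd_Dop hL hinj, Dop_DinvStd hL hinj, fun g => ?_⟩
  -- `c := D⁻¹g` satisfies `c + S c = (QΓQ*)⁻¹ g`, so `‖c‖ ≤ C_Q‖g‖ + ½‖c‖`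
  set c := DinvStd hL A g with hc
  have h1 : c + pert hL A c = (QGammaQstar hL).symm g := by
    apply (QGammaQstar hL).injective
    rw [LinearEquiv.apply_symm_apply, ← Dop_eq_pert, hc, Dop_DinvStd hL hinj]
  have h2 : ‖c‖ ≤ CQ * ‖g‖ + 1 / 2 * ‖c‖ := by
    calc ‖c‖ = ‖(c + pert hL A c) - pert hL A c‖ := by rw [add_sub_cancel_right]
      _ ≤ ‖c + pert hL A c‖ + ‖pert hL A c‖ := norm_sub_le _ _
      _ ≤ CQ * ‖g‖ + 1 / 2 * ‖c‖ := add_le_add (by rw [h1]; exact hQ g) (hS c)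
  linarith

/-- **Theorem 1 from Lemma (infty-bounds).**  If, for the fixed `L` and uniformly in `n₁`, «`‖Γ‖_{∞,∞;Ω} ≤ C`» and
«`‖(QΓQ*)⁻¹‖_{∞,∞;Ω₁} ≤ C`» (Lemma (infty-bounds)), then Theorem (main-theorem-intext)/Theorem 1 holds: Lemma (Q-G-R-Q-lemma)
supplies the hypothesis `hD` of `theorem1_of_Linfty_bounds`. [cite: DybalskiStottmeisterTanimoto2024, §4.3 Lemma (infty-bounds); §4.4 Lemma (Q-G-R-Q-lemma); §4.1 Theorem (main-theorem-intext)] -/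
theorem theorem1_of_infty_bounds (hL : 0 < L) {CΓ CQ : ℝ}
    (hΓ : ∀ {n₁ : ℕ} (f : Site L n₁ → su2), ‖Gamma hL f‖ ≤ CΓ * ‖f‖)
    (hQ : ∀ {n₁ : ℕ} (g : CSite n₁ → su2), ‖(QGammaQstar hL).symm g‖ ≤ CQ * ‖g‖) : Theorem1 L := by
  have hΓ' : ∀ {n₁ : ℕ} (f : Site L n₁ → su2), ‖Gamma hL f‖ ≤ max CΓ 0 * ‖f‖ :=
    fun f => (hΓ f).trans (mul_le_mul_of_nonneg_right (le_max_left _ _) (norm_nonneg _))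
  have hQ' : ∀ {n₁ : ℕ} (g : CSite n₁ → su2), ‖(QGammaQstar hL).symm g‖ ≤ max CQ 0 * ‖g‖ :=
    fun g => (hQ g).trans (mul_le_mul_of_nonneg_right (le_max_left _ _) (norm_nonneg _))
  exact theorem1_of_Linfty_bounds hL (CD := 2 * max CQ 0) (κ₀ := 1 / (4 * max CQ 0 * max CΓ 0 + 4)) (by positivity) hΓ'
    (fun A => DinvStd hL A) (fun A hA => QGRQ_lemma hL (le_max_right _ _) (le_max_right _ _) hΓ' hQ' hA)

end

end Literature.MathematicalPhysics.QuantumFieldTheory.DybalskiStottmeisterTanimoto2024.DST24MainTheorem
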